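import Mathlib.Topology.Order.ProjIcc
import Mathlib.Analysis.Calculus.Deriv.Basic
import Literature.Topology.PlaneTopology.ArgumentIncrement
import Literature.Topology.FourManifolds.KhResolutions
import Mathlib.Analysis.Calculus.Deriv.Shift
import Mathlib.Analysis.Calculus.Deriv.Comp
import Mathlib.Algebra.BigOperators.Fin
import Mathlib.Order.Interval.Finset.Fin
import Mathlib.Data.ZMod.Basic
import HarnessLib

/-!
# Gauss's parity condition for regular projections of knots

Topic: Topology / FourManifolds (companion of `GaussDiagrams.lean`, the regular projections
`Knot.RegularProjection` of smooth knots and their Gauss diagrams, and of the `KhResolutions*`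
files, where the merge/split dichotomy of the cube of resolutions is reduced to the parity
condition proved here, `KhResolutionsDichotomyProofs`).

Main result (`Knot.RegularProjection.overPos_mod_two_ne_underPos_mod_two`,
`Knot.RegularProjection.odd_overPos_add_underPos`): **in the Gauss diagram read off a regular
projection of a knot, the two passages through every crossing occupy positions of different
parity** — walking along the knot from one passage through a crossing back to it, one meets an
even number of crossing passages. This is Gauss's necessary condition for a Gauss word to be the
word of a closed normal plane curve (C. F. Gauss, *Werke* VIII, pp. 272, 282–286), in the form
"a planar Gauss code is evenly intersticed" (Kauffman (1999), §3.2, Lemma 1: "this follows directly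
from the Jordan curve theorem in the plane").

## The proof

Everything is derived from the fields of `Knot.RegularProjection` (the plane curve
`γ = K.planeCurve` has nowhere-vanishing `deriv`, hence is differentiable everywhere; the listed
double points are transversal and are the only coincidences `γ s = γ t`, `eq_or_crossing`) and the
winding-number toolkit of `Literature/Topology/PlaneTopology` (`wind`, `HasLogOn`,
`wind_sub_eq_of_mem_connectedComponentIn`, the Möbius map `crossRatioFn` and its side functional
`segSide`). No smoothness beyond pointwise differentiability is used, and the Jordan curve theorem
is not needed: winding numbers replace it.

Fix a chord with positions `a < b` (`b = partner a`) and parameters `θ a < θ b`; the curve on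
`[θ a, θ b]` is a loop `Λ` at the double point `x₀` (`loopCurve`), and `W(t)`, the winding number
of `Λ` about the moving point `γ t` (`windAt`), is studied for `t` in the complementary window
`(θ b, θ a + 2π)`:

* `exists_eq_crossTime`: `γ t` lies on the loop only at the *cross times* of the marked points
  `q` outside `[a, b]` whose partner lies strictly inside (`crossSet`; one for each chord
  interlaced with `{a, b}`), by `eq_or_crossing` and bookkeeping modulo `2π`; hence `W` is
  constant between cross times (`windAt_eq_windAt`);
* `windAt_crossTime_add_sub`: at a cross time `W` jumps by `±1`. The local engine
  (`GaussParity.wind_sub_wind_eq_one`): near the double point `y` the loop stays in a thin cone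
  around its tangent line (pointwise differentiability, `HasDerivAt.exists_cone`) and elsewhere at
  positive distance from `y` (compactness); for the two points `y ± ε w` on the *exact* tangent line
  of the crossing branch, the Möbius image `(Λ - ℓ)/(Λ - r)` crosses the cut `(-∞, 0]` exactly
  once, transversally (`incrOn_crossRatioFn_of_cross`, the continuous-path version of
  `logInc_crossRatioFn_lineMap_of_cross`), so the two winding numbers differ by one; and the actual
  points `γ(t₀ ± ε)` are joined to `y ± ε w` by short segments missing the loop
  (`wind_sub_eq_of_near`);
* `windAt_corner`: just after leaving `x₀` (at `θ b + ε`) and just before returning (at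
  `θ a + 2π - ε`) the values of `W` agree: the segment `[x₀ + ε γ'(θ b), x₀ - ε γ'(θ a)]` cuts the
  corner of the loop on the side opposite to the wedge it occupies (`wind_sub_eq_of_corner`);
* `even_card_crossSet`: summing the jumps over the increasingly ordered cross times gives `0`, a
  sum of `m` odd integers, so `m` is even; and `m ≡ b - a - 1 (mod 2)` since the other marked
  points strictly between `a` and `b` come in partner pairs (`card_Ioo_mod_two`).

## Sources

* C. F. Gauss, *Werke*, Bd. VIII, Teubner (1900), 272, 282–286 (the parity condition for
  "Tractfiguren").
* L. H. Kauffman, *Virtual knot theory*, European J. Combin. 20 (1999) 663–690, §3.2, Lemma 1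
  (planar Gauss codes are evenly intersticed). [cite: Kauffman1999, §3.2 Lemma 1]
* L. V. Ahlfors, *Complex Analysis*, 3rd ed. (1979), §4.2.1, Lemmas 1–2 (winding numbers: local
  constancy and the jump across an arc).
* O. Viro, *Khovanov homology, its definitions and ramifications*, Fund. Math. 184 (2004), §5.2
  (where the condition enters the Khovanov complex of a planar diagram).

## Design notes

* No named fact and no `Prop`-valued definition is introduced (D-0026); the auxiliary definitions
  (`GaussParity.incrOn`, `Knot.cplaneCurve`, `Knot.cplaneDeriv`, `loopParam`, `loopCurve`,
  `windAt`, `crossTime`, `crossSet`) are concrete and documented where declared.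
* The generic plane-topology lemmas of the local engine live in the sub-namespace
  `Literature.Topology.FourManifolds.GaussParity` of this file (they are phrased for an arbitrary
  continuous loop `Λ : ℝ → ℂ` read on `[0, 1]`, in the conventions of `PlaneTopology.WindingNumber`).
* The plane `ℝ × ℝ` of `GaussDiagrams` is read in `ℂ` through `Complex.equivRealProdCLM.symm`;
  transversality `det (γ' over, γ' under) ≠ 0` becomes `Im (γ'ₒ · conj γ'ᵤ) ≠ 0`
  (`im_mul_conj_equivRealProdCLM_symm`).
-/

noncomputable section

open Complex Set Filter Topology
open scoped Real

namespace Literature.Topology.FourManifolds.GaussParity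

open Literature.Topology.PlaneTopology

/-! ### The increment of a continuous logarithm along a general interval -/

/-- The **increment of the logarithm** of `f : ℝ → ℂ` along `[a, b]`: `l b - l a` for a continuous
logarithm `l` of `f` on `[a, b]` (independent of the choice, `incrOn_eq`); junk value if `f` has
no continuous logarithm there. (`logInc` of `ArgumentIncrement` is the case `[0, 1]`,
`incrOn_zero_one`.) [folklore] -/
def incrOn (f : ℝ → ℂ) (a b : ℝ) : ℂ := by
  classical
  exact if h : HasLogOn f (Icc a b) then h.choose b - h.choose a else 0

/-- **Independence of the logarithm**: `incrOn f a b = l b - l a` for every continuous logarithm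
`l` of `f` on `[a, b]`. [folklore] -/
theorem incrOn_eq {f l : ℝ → ℂ} {a b : ℝ} (hab : a ≤ b) (hl : ContinuousOn l (Icc a b))
    (hle : ∀ t ∈ Icc a b, exp (l t) = f t) : incrOn f a b = l b - l a := by
  classical
  have h : HasLogOn f (Icc a b) := ⟨l, hl, hle⟩
  rw [incrOn, dif_pos h]
  obtain ⟨n, hn⟩ := exists_int_eq_add_of_exp_eq isPreconnected_Icc h.choose_spec.1 hl
    (fun t ht => by rw [h.choose_spec.2 t ht, hle t ht])
  rw [hn b (right_mem_Icc.2 hab), hn a (left_mem_Icc.2 hab)]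
  ring

/-- On `[0, 1]` the increment is `logInc`. [folklore] -/
theorem incrOn_zero_one (f : ℝ → ℂ) : incrOn f 0 1 = logInc f := by
  classical
  by_cases h : HasLogOn f (Icc 0 1)
  · obtain ⟨l, hl, hle⟩ := h
    rw [incrOn_eq zero_le_one hl hle, logInc_eq hl hle]
  · rw [incrOn, dif_neg h, logInc_of_not_hasLogOn h]

/-- Invariance under change of the function on `[a, b]`. [folklore] -/
theorem incrOn_congr {f g : ℝ → ℂ} {a b : ℝ} (hab : a ≤ b) (h : EqOn f g (Icc a b)) :
    incrOn f a b = incrOn g a b := by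
  classical
  by_cases hf : HasLogOn f (Icc a b)
  · obtain ⟨l, hl, hle⟩ := hf
    rw [incrOn_eq hab hl hle, incrOn_eq hab hl fun t ht => (hle t ht).trans (h ht)]
  · have hg : ¬ HasLogOn g (Icc a b) := fun hg => hf (hg.congr h.symm)
    rw [incrOn, dif_neg hf, incrOn, dif_neg hg]

/-- **Additivity**: for `a ≤ m ≤ b`, the increment along `[a, b]` is the sum of the increments
along `[a, m]` and `[m, b]`. [folklore] -/
theorem incrOn_add {f : ℝ → ℂ} {a m b : ℝ} (ham : a ≤ m) (hmb : m ≤ b)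
    (h : HasLogOn f (Icc a b)) : incrOn f a b = incrOn f a m + incrOn f m b := by
  obtain ⟨l, hl, hle⟩ := h
  rw [incrOn_eq (ham.trans hmb) hl hle,
    incrOn_eq ham (hl.mono (Icc_subset_Icc_right hmb)) fun t ht =>
      hle t (Icc_subset_Icc_right hmb ht),
    incrOn_eq hmb (hl.mono (Icc_subset_Icc_left ham)) fun t ht =>
      hle t (Icc_subset_Icc_left ham ht)]
  ring

/-- **Principal branch**: if `f` is continuous on `[a, b]` with values in the slit plane, the
increment is `log (f b) - log (f a)`. [folklore] -/
theorem incrOn_eq_log_sub_log {f : ℝ → ℂ} {a b : ℝ} (hab : a ≤ b) (hf : ContinuousOn f (Icc a b))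
    (h : ∀ t ∈ Icc a b, f t ∈ slitPlane) : incrOn f a b = log (f b) - log (f a) :=
  incrOn_eq hab (ContinuousOn.clog hf h) fun t ht => exp_log (slitPlane_ne_zero (h t ht))

/-- Increment of a quotient. [folklore] -/
theorem incrOn_div {f g : ℝ → ℂ} {a b : ℝ} (hab : a ≤ b) (hf : HasLogOn f (Icc a b))
    (hg : HasLogOn g (Icc a b)) :
    incrOn (fun t => f t / g t) a b = incrOn f a b - incrOn g a b := by
  obtain ⟨l, hl, hle⟩ := hf
  obtain ⟨m, hm, hme⟩ := hg
  rw [incrOn_eq hab hl hle, incrOn_eq hab hm hme,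
    incrOn_eq hab (l := fun t => l t - m t) (hl.sub hm) fun t ht => by
      simp only [exp_sub, hle t ht, hme t ht]]
  ring

/-- For a loop on `[0, 1]` the increment is `2πi` times the winding number. [folklore] -/
theorem incrOn_eq_wind_mul {f : ℝ → ℂ} (hf : IsNonvanishingLoop f) :
    incrOn f 0 1 = wind f * (2 * π * I) := by
  rw [incrOn_zero_one, logInc_eq_wind_mul hf]

/-! ### One transversal crossing of a segment by a continuous path -/

/-- **One transversal crossing of the cut adds `2πi` (continuous paths).** Let `z` be continuous on
`[a, b]`, let `a < τ < b`, and suppose `z t` lies strictly on the positive side of the segment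
`[ℓ, r]` (`segSide`) for `t < τ`, strictly on the negative side for `t > τ`, and `z τ` lies on
the open segment `(ℓ, r)`. Then along `t ↦ F(z t)`, `F(z) = (z - ℓ)/(z - r)`, the increment of the
logarithm over `[a, b]` is the principal-branch difference **plus `2πi`**. (Generalises
`logInc_crossRatioFn_lineMap_of_cross` from straight to continuous paths; same proof.) Ahlfors,
*Complex Analysis*, §4.2.1, Lemma 2. [folklore] -/
theorem incrOn_crossRatioFn_of_cross {z : ℝ → ℂ} {a b τ : ℝ} {ℓ r : ℂ}
    (hz : ContinuousOn z (Icc a b)) (haτ : a < τ) (hτb : τ < b)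
    (hpos : ∀ t ∈ Ico a τ, 0 < segSide ℓ r (z t)) (hneg : ∀ t ∈ Ioc τ b, segSide ℓ r (z t) < 0)
    (hzτ : z τ ∈ openSegment ℝ ℓ r) :
    incrOn (fun t => crossRatioFn ℓ r (z t)) a b =
      log (crossRatioFn ℓ r (z b)) - log (crossRatioFn ℓ r (z a)) + 2 * π * I := by
  have hab : a ≤ b := (haτ.trans hτb).le
  have hlr : ℓ ≠ r := ne_of_segSide_ne_zero (hpos a ⟨le_rfl, haτ⟩).ne'
  -- extend `z` by constants outside `[a, b]`
  set zz : ℝ → ℂ := fun t => z (projIcc a b hab t) with hzz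
  have hzz_mem : ∀ t ∈ Icc a b, zz t = z t := fun t ht => by
    simp only [hzz, projIcc_of_mem hab ht]
  have hzzc : Continuous zz :=
    hz.comp_continuous (continuous_subtype_val.comp continuous_projIcc) fun t => (projIcc a b hab t).2
  have hzzτ : zz τ = z τ := hzz_mem τ ⟨haτ.le, hτb.le⟩
  have hpos' : ∀ t, t < τ → 0 < segSide ℓ r (zz t) := by
    intro t ht
    by_cases hta : a ≤ t
    · rw [hzz_mem t ⟨hta, (ht.trans hτb).le⟩]; exact hpos t ⟨hta, ht⟩
    · simp only [hzz, projIcc_of_le_left hab (not_le.1 hta).le]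
      exact hpos a ⟨le_rfl, haτ⟩
  have hneg' : ∀ t, τ < t → segSide ℓ r (zz t) < 0 := by
    intro t ht
    by_cases htb : t ≤ b
    · rw [hzz_mem t ⟨(haτ.trans ht).le, htb⟩]; exact hneg t ⟨ht, htb⟩
    · simp only [hzz, projIcc_of_right_le hab (not_le.1 htb).le]
      exact hneg b ⟨hτb, le_rfl⟩
  set g : ℝ → ℂ := fun t => crossRatioFn ℓ r (zz t) with hg
  have hzτ' : zz τ ∈ openSegment ℝ ℓ r := by rw [hzzτ]; exact hzτ
  obtain ⟨hgτre, hgτim⟩ := crossRatioFn_of_mem_openSegment hlr hzτ'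
  -- `zz t ≠ ℓ`, `zz t ≠ r`
  have hline : ∀ t, t ≠ τ → segSide ℓ r (zz t) ≠ 0 := by
    intro t ht
    rcases lt_or_gt_of_ne ht with h | h
    · exact (hpos' t h).ne'
    · exact (hneg' t h).ne
  have hzne : ∀ t, zz t ≠ ℓ ∧ zz t ≠ r := by
    intro t
    by_cases ht : t = τ
    · subst ht
      exact ⟨fun h => hlr (left_mem_openSegment_iff.1 (h ▸ hzτ')),
        fun h => hlr (right_mem_openSegment_iff.1 (h ▸ hzτ'))⟩
    · exact ⟨fun h => hline t ht (by rw [h]; exact segSide_left ℓ r),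
        fun h => hline t ht (by rw [h]; exact segSide_right ℓ r)⟩
  have hgc : ∀ t, ContinuousAt g t := fun t =>
    (continuousAt_crossRatioFn (hzne t).2).comp hzzc.continuousAt
  have hg0 : ∀ t, g t ≠ 0 := fun t => crossRatioFn_ne_zero (hzne t).1 (hzne t).2
  have hgim : ∀ t, (g t).im = segSide ℓ r (zz t) / normSq (zz t - r) := fun t =>
    crossRatioFn_im _ _ _
  have hnsq : ∀ t, 0 < normSq (zz t - r) := fun t => normSq_pos.2 (sub_ne_zero.2 (hzne t).2)
  have hslit : ∀ t, t ≠ τ → g t ∈ slitPlane := by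
    intro t ht
    rw [mem_slitPlane_iff]
    right
    rw [hgim]
    rcases lt_or_gt_of_ne ht with h | h
    · exact (div_pos (hpos' t h) (hnsq t)).ne'
    · exact (div_neg_of_neg_of_pos (hneg' t h) (hnsq t)).ne
  have him_nonneg : ∀ t, t ≤ τ → 0 ≤ (g t).im := by
    intro t ht
    rcases ht.lt_or_eq with h | h
    · rw [hgim]; exact (div_pos (hpos' t h) (hnsq t)).le
    · rw [h]; exact hgτim.symm.le
  have him_neg : ∀ t, τ < t → (g t).im < 0 := fun t ht => by
    rw [hgim]; exact div_neg_of_neg_of_pos (hneg' t ht) (hnsq t)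
  have hre_ev : ∀ᶠ t in 𝓝 τ, (g t).re < 0 :=
    (hgc τ).eventually ((isOpen_lt continuous_re continuous_const).mem_nhds hgτre)
  -- the continuous logarithm
  set l : ℝ → ℂ := fun t => if t ≤ τ then log (g t) else log (g t) + 2 * π * I with hl
  have hle : ∀ t, exp (l t) = g t := by
    intro t
    simp only [hl]
    split_ifs
    · exact exp_log (hg0 t)
    · rw [exp_add, exp_log (hg0 t), Complex.exp_two_pi_mul_I, mul_one]
  have hlc : ∀ t, ContinuousAt l t := by
    intro t
    rcases lt_trichotomy t τ with ht | ht | ht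
    · have hev : l =ᶠ[𝓝 t] fun s => log (g s) := by
        filter_upwards [Iio_mem_nhds ht] with s hs
        simp only [hl, if_pos (le_of_lt (mem_Iio.1 hs))]
      exact ((continuousAt_clog (hslit t ht.ne)).comp (hgc t)).congr hev.symm
    · rw [ht]
      have hev : l =ᶠ[𝓝 τ] fun s => log (-g s) + π * I := by
        filter_upwards [hre_ev] with s hs
        simp only [hl]
        split_ifs with h
        · exact log_eq_log_neg_add_of_im_nonneg hs (him_nonneg s h)
        · rw [log_eq_log_neg_sub_of_im_neg (him_neg s (not_le.1 h))]; ring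
      refine ContinuousAt.congr ?_ hev.symm
      refine ContinuousAt.add ?_ continuousAt_const
      refine (continuousAt_clog ?_).comp (hgc τ).neg
      rw [mem_slitPlane_iff]; left; simp only [neg_re]; linarith
    · have hev : l =ᶠ[𝓝 t] fun s => log (g s) + 2 * π * I := by
        filter_upwards [Ioi_mem_nhds ht] with s hs
        simp only [hl, if_neg (not_le.2 (mem_Ioi.1 hs))]
      exact (((continuousAt_clog (hslit t ht.ne')).comp (hgc t)).add continuousAt_const).congr
        hev.symm
  -- evaluate
  have hcongr : EqOn (fun t => crossRatioFn ℓ r (z t)) g (Icc a b) := fun t ht => by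
    simp only [hg, hzz_mem t ht]
  rw [incrOn_congr hab hcongr,
    incrOn_eq hab (continuousOn_of_forall_continuousAt fun t _ => hlc t) fun t _ => hle t]
  simp only [hl, if_pos haτ.le, if_neg (not_le.2 hτb), hg, hzz_mem a (left_mem_Icc.2 hab),
    hzz_mem b (right_mem_Icc.2 hab)]
  ring

/-! ### Small geometric lemmas -/

/-- **Cone estimate at a point of differentiability**: `‖f y - f x - (y - x) f'‖ ≤ κ |y - x|` for
`y` near `x`, for every `κ > 0`. [folklore] -/
theorem HasDerivAt.exists_cone {f : ℝ → ℂ} {f' : ℂ} {x : ℝ} (h : HasDerivAt f f' x) {κ : ℝ}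
    (hκ : 0 < κ) :
    ∃ δ > 0, ∀ y : ℝ, |y - x| < δ → ‖f y - f x - ((y - x : ℝ) : ℂ) * f'‖ ≤ κ * |y - x| := by
  have h1 := (hasDerivAt_iff_isLittleO.1 h).def hκ
  obtain ⟨δ, hδ, hball⟩ := Metric.eventually_nhds_iff.1 h1
  refine ⟨δ, hδ, fun y hy => ?_⟩
  have := hball (by rw [Real.dist_eq]; exact hy)
  simpa only [Complex.real_smul, Real.norm_eq_abs] using this

/-- **Positive distance on a compact set**: a function continuous on a compact set and avoiding
the value `y` there stays at distance `≥ η > 0` from `y`. [folklore] -/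
theorem exists_pos_forall_le_norm_sub {Λ : ℝ → ℂ} {S : Set ℝ} (hS : IsCompact S)
    (hΛ : ContinuousOn Λ S) {y : ℂ} (hne : ∀ s ∈ S, Λ s ≠ y) :
    ∃ η > 0, ∀ s ∈ S, η ≤ ‖Λ s - y‖ := by
  rcases S.eq_empty_or_nonempty with rfl | hSne
  · exact ⟨1, one_pos, fun s hs => hs.elim⟩
  obtain ⟨s₀, hs₀, hmin⟩ := hS.exists_isMinOn hSne (hΛ.sub continuousOn_const).norm
  exact ⟨‖Λ s₀ - y‖, norm_pos_iff.2 (sub_ne_zero.2 (hne s₀ hs₀)), fun s hs => hmin hs⟩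

/-- **Coordinates along two independent directions.** If `α V + β w = e` then
`|α| · |Im (V w̄)| ≤ ‖e‖ ‖w‖` and `|β| · |Im (V w̄)| ≤ ‖e‖ ‖V‖`. [folklore] -/
theorem abs_mul_im_le_of_eq {V w e : ℂ} {α β : ℝ} (h : (α : ℂ) * V + (β : ℂ) * w = e) :
    |α| * |(V * starRingEnd ℂ w).im| ≤ ‖e‖ * ‖w‖ ∧
      |β| * |(V * starRingEnd ℂ w).im| ≤ ‖e‖ * ‖V‖ := by
  have hw : (e * starRingEnd ℂ w).im = α * (V * starRingEnd ℂ w).im := by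
    rw [← h]
    simp only [add_mul, Complex.add_im, mul_assoc, Complex.im_ofReal_mul, Complex.mul_conj,
      Complex.ofReal_im, mul_zero, add_zero]
  have e1 : (w * starRingEnd ℂ V).im = -(V * starRingEnd ℂ w).im := by
    rw [← Complex.conj_conj (w * starRingEnd ℂ V), Complex.conj_im, map_mul, Complex.conj_conj,
      mul_comm]
  have hV : (e * starRingEnd ℂ V).im = -(β * (V * starRingEnd ℂ w).im) := by
    rw [← h]
    simp only [add_mul, Complex.add_im, mul_assoc, Complex.im_ofReal_mul, Complex.mul_conj,
      Complex.ofReal_im, mul_zero, zero_add, e1, mul_neg]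
  constructor
  · calc |α| * |(V * starRingEnd ℂ w).im| = |(e * starRingEnd ℂ w).im| := by
          rw [hw, abs_mul]
      _ ≤ ‖e * starRingEnd ℂ w‖ := Complex.abs_im_le_norm _
      _ = ‖e‖ * ‖w‖ := by rw [norm_mul, Complex.norm_conj]
  · calc |β| * |(V * starRingEnd ℂ w).im| = |(e * starRingEnd ℂ V).im| := by
          rw [hV, abs_neg, abs_mul]
      _ ≤ ‖e * starRingEnd ℂ V‖ := Complex.abs_im_le_norm _
      _ = ‖e‖ * ‖V‖ := by rw [norm_mul, Complex.norm_conj]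

/-- The side functional of the segment `[y + ε w, y - ε w]` at `y + ζ` is `2 ε Im (ζ w̄)`.
[folklore] -/
theorem segSide_add_sub (y w ζ : ℂ) (ε : ℝ) :
    segSide (y + ε * w) (y - ε * w) (y + ζ) = 2 * ε * (ζ * starRingEnd ℂ w).im := by
  unfold segSide
  have : (y + ζ - (y + ε * w)) * starRingEnd ℂ (y + ζ - (y - ε * w)) =
      ζ * starRingEnd ℂ ζ + ε * (ζ * starRingEnd ℂ w) - ε * starRingEnd ℂ (ζ * starRingEnd ℂ w)
        - (ε : ℂ) ^ 2 * (w * starRingEnd ℂ w) := by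
    simp only [map_sub, map_add, map_mul, Complex.conj_ofReal, Complex.conj_conj]
    ring
  rw [this]
  simp only [Complex.sub_im, Complex.add_im, Complex.mul_conj, ← Complex.ofReal_pow,
    Complex.ofReal_im, Complex.conj_im, Complex.im_ofReal_mul]
  ring

/-- `y` is on the open segment from `y + u` to `y - u` (its midpoint). [folklore] -/
theorem mem_openSegment_add_sub (y u : ℂ) : y ∈ openSegment ℝ (y + u) (y - u) := by
  rw [openSegment_eq_image']
  refine ⟨1 / 2, ⟨by norm_num, by norm_num⟩, ?_⟩
  simp only [Complex.real_smul]
  push_cast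
  ring

/-! ### Winding numbers are constant along paths avoiding the loop -/

/-- **The winding number about a moving point is constant** as long as the point moves
continuously in the complement of the loop. [folklore] -/
theorem wind_sub_eq_of_path {Λ : ℝ → ℂ} (hΛ : ContinuousOn Λ (Icc 0 1)) (h01 : Λ 0 = Λ 1)
    {c : ℝ → ℂ} {t₁ t₂ : ℝ} (ht : t₁ ≤ t₂) (hc : ContinuousOn c (Icc t₁ t₂))
    (hdisj : ∀ t ∈ Icc t₁ t₂, c t ∉ Λ '' Icc 0 1) :
    wind (fun s => Λ s - c t₁) = wind (fun s => Λ s - c t₂) := by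
  have hK : IsClosed (Λ '' Icc 0 1) := (isCompact_Icc.image_of_continuousOn hΛ).isClosed
  refine wind_sub_eq_of_mem_connectedComponentIn hΛ h01 hK (mapsTo_image Λ _) ?_
  have hsub : c '' Icc t₁ t₂ ⊆ connectedComponentIn (Λ '' Icc 0 1)ᶜ (c t₁) :=
    (isPreconnected_Icc.image c hc).subset_connectedComponentIn
      (mem_image_of_mem c (left_mem_Icc.2 ht)) (image_subset_iff.2 fun t ht' => hdisj t ht')
  exact hsub (mem_image_of_mem c (right_mem_Icc.2 ht))

/-! ### The local engine at a transversal double point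

The following three lemmas concern a loop `Λ` (read on `[0, 1]`) passing at the interior
parameter `σ₀` through a point `y` with velocity `V`, *within a cone*: `Λ s = y + (s - σ₀) V +
O(κ |s - σ₀|)` on the window `|s - σ₀| ≤ δ`, and staying at distance `≥ η` from `y` off the window;
and a second direction `w` transversal to `V` (`Im (V w̄) ≠ 0`) with `κ (‖V‖ + ‖w‖) < |Im (V w̄)|`.
-/

/-- **Off the loop.** A point `y + μ w + e` with `‖e‖ ≤ κ |μ|` and `‖μ w + e‖ < η` lies on the loop
only if `μ = 0` (and then only at the parameter `σ₀`). [folklore] -/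
theorem eq_of_loop_eq_add {Λ : ℝ → ℂ} {σ₀ δ κ η : ℝ} {y V w : ℂ}
    (hcone : ∀ s, |s - σ₀| ≤ δ → ‖Λ s - y - ((s - σ₀ : ℝ) : ℂ) * V‖ ≤ κ * |s - σ₀|)
    (hfar : ∀ s ∈ Icc (0 : ℝ) 1, δ ≤ |s - σ₀| → η ≤ ‖Λ s - y‖)
    (hκ : κ * (‖V‖ + ‖w‖) < |(V * starRingEnd ℂ w).im|)
    {s : ℝ} (hs : s ∈ Icc (0 : ℝ) 1) {μ : ℝ} {e : ℂ} (he : ‖e‖ ≤ κ * |μ|)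
    (hη : ‖(μ : ℂ) * w + e‖ < η) (h : Λ s = y + μ * w + e) : μ = 0 ∧ s = σ₀ := by
  by_cases hsd : δ ≤ |s - σ₀|
  · have := hfar s hs hsd
    rw [h, add_assoc, add_sub_cancel_left] at this
    exact absurd (this.trans_lt hη) (lt_irrefl _)
  · set e' := Λ s - y - ((s - σ₀ : ℝ) : ℂ) * V with he'
    have hcs := hcone s (not_le.1 hsd).le
    have heq : ((s - σ₀ : ℝ) : ℂ) * V + ((-μ : ℝ) : ℂ) * w = e - e' := by
      rw [he', h]; push_cast; ring
    obtain ⟨h1, h2⟩ := abs_mul_im_le_of_eq heq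
    rw [abs_neg] at h2
    set D := |(V * starRingEnd ℂ w).im| with hD
    have hee : ‖e - e'‖ ≤ κ * |μ| + κ * |s - σ₀| := (norm_sub_le e e').trans (add_le_add he hcs)
    have hsum : (|s - σ₀| + |μ|) * D ≤ (|s - σ₀| + |μ|) * (κ * (‖V‖ + ‖w‖)) := by
      have hw0 := norm_nonneg w
      have hV0 := norm_nonneg V
      nlinarith [mul_le_mul_of_nonneg_right hee hw0, mul_le_mul_of_nonneg_right hee hV0]
    by_cases h0 : |s - σ₀| + |μ| = 0
    · have hμ : |μ| = 0 := by linarith [abs_nonneg (s - σ₀), abs_nonneg μ]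
      have hs0 : |s - σ₀| = 0 := by linarith [abs_nonneg (s - σ₀), abs_nonneg μ]
      exact ⟨abs_eq_zero.1 hμ, sub_eq_zero.1 (abs_eq_zero.1 hs0)⟩
    · have hpos : 0 < |s - σ₀| + |μ| := lt_of_le_of_ne (by positivity) (Ne.symm h0)
      have := le_of_mul_le_mul_left hsum hpos
      exact absurd (this.trans_lt hκ) (lt_irrefl _)

/-- **Approaching the loop along the transversal direction.** The winding numbers of the loop
about a point `z₀` with `‖z₀ - (y + μ w)‖ ≤ κ |μ|` and about `y + μ w` agree (`μ ≠ 0` small):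
the straight segment between them misses the loop. [folklore] -/
theorem wind_sub_eq_of_near {Λ : ℝ → ℂ} {σ₀ δ κ η : ℝ} {y V w : ℂ} (hΛ : Continuous Λ)
    (h01 : Λ 0 = Λ 1)
    (hcone : ∀ s, |s - σ₀| ≤ δ → ‖Λ s - y - ((s - σ₀ : ℝ) : ℂ) * V‖ ≤ κ * |s - σ₀|)
    (hfar : ∀ s ∈ Icc (0 : ℝ) 1, δ ≤ |s - σ₀| → η ≤ ‖Λ s - y‖)
    (hκ : κ * (‖V‖ + ‖w‖) < |(V * starRingEnd ℂ w).im|) {μ : ℝ} (hμ : μ ≠ 0)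
    (hη : |μ| * ‖w‖ + κ * |μ| < η) {z₀ : ℂ} (hz₀ : ‖z₀ - (y + μ * w)‖ ≤ κ * |μ|) :
    wind (fun s => Λ s - z₀) = wind (fun s => Λ s - (y + μ * w)) := by
  set c : ℝ → ℂ := fun θ => z₀ + (θ : ℂ) * ((y + μ * w) - z₀) with hc
  have hc0 : c 0 = z₀ := by simp [hc]
  have hc1 : c 1 = y + μ * w := by simp [hc]
  have hcc : Continuous c := by
    simp only [hc]
    fun_prop
  rw [← hc0, ← hc1]
  refine wind_sub_eq_of_path hΛ.continuousOn h01 zero_le_one hcc.continuousOn fun θ hθ hmem => ?_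
  obtain ⟨s, hs, hsθ⟩ := hmem
  -- `c θ = y + μ w + e` with `e = (1 - θ) (z₀ - y - μ w)`
  set e : ℂ := ((1 - θ : ℝ) : ℂ) * (z₀ - (y + μ * w)) with he
  have hce : c θ = y + μ * w + e := by simp only [hc, he]; push_cast; ring
  have hθ1 : |1 - θ| ≤ 1 := by rw [abs_le]; constructor <;> linarith [hθ.1, hθ.2]
  have he_le : ‖e‖ ≤ κ * |μ| := by
    rw [he, norm_mul, Complex.norm_real, Real.norm_eq_abs]
    calc |1 - θ| * ‖z₀ - (y + μ * w)‖ ≤ 1 * (κ * |μ|) :=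
          mul_le_mul hθ1 hz₀ (norm_nonneg _) zero_le_one
      _ = κ * |μ| := one_mul _
  have hη' : ‖(μ : ℂ) * w + e‖ < η := by
    calc ‖(μ : ℂ) * w + e‖ ≤ ‖(μ : ℂ) * w‖ + ‖e‖ := norm_add_le _ _
      _ ≤ |μ| * ‖w‖ + κ * |μ| := by
          rw [norm_mul, Complex.norm_real, Real.norm_eq_abs]; exact add_le_add le_rfl he_le
      _ < η := hη
  obtain ⟨hμ0, -⟩ := eq_of_loop_eq_add hcone hfar hκ hs he_le hη' (hsθ.trans hce)
  exact hμ hμ0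

/-- Points of the segment `[y + ε w, y - ε w]` are of the form `y + μ w` with `|μ| ≤ ε`.
[folklore] -/
theorem exists_eq_add_mul_of_mem_segment {y w z : ℂ} {ε : ℝ} (hε : 0 ≤ ε)
    (hz : z ∈ segment ℝ (y + ε * w) (y - ε * w)) : ∃ μ : ℝ, |μ| ≤ ε ∧ z = y + μ * w := by
  rw [segment_eq_image_lineMap] at hz
  obtain ⟨θ, hθ, rfl⟩ := hz
  refine ⟨(1 - 2 * θ) * ε, ?_, ?_⟩
  · rw [abs_mul, abs_of_nonneg hε]
    have : |1 - 2 * θ| ≤ 1 := by rw [abs_le]; constructor <;> linarith [hθ.1, hθ.2]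
    nlinarith
  · rw [AffineMap.lineMap_apply_module]
    simp only [Complex.real_smul]
    push_cast
    ring

/-- **The jump.** With `Im (V w̄) < 0`, the winding number of the loop about `y + ε w` exceeds
that about `y - ε w` by exactly one (`ε > 0` small): splitting `[0, 1]` at `σ₀ ± δ`, the Möbius
image `F ∘ Λ`, `F(z) = (z - ℓ)/(z - r)` for `ℓ = y + ε w`, `r = y - ε w`, stays in the slit plane
off the window and crosses the cut once, transversally, on the window
(`incrOn_crossRatioFn_of_cross`). Ahlfors, *Complex Analysis*, §4.2.1, Lemma 2. [folklore] -/
theorem wind_sub_wind_eq_one {Λ : ℝ → ℂ} {σ₀ δ κ η ε : ℝ} {y V w : ℂ} (hΛ : Continuous Λ)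
    (h01 : Λ 0 = Λ 1) (hδ : 0 < δ) (hδσ : δ < σ₀) (hσδ : σ₀ + δ < 1) (hy : Λ σ₀ = y)
    (hcone : ∀ s, |s - σ₀| ≤ δ → ‖Λ s - y - ((s - σ₀ : ℝ) : ℂ) * V‖ ≤ κ * |s - σ₀|)
    (hfar : ∀ s ∈ Icc (0 : ℝ) 1, δ ≤ |s - σ₀| → η ≤ ‖Λ s - y‖)
    (hκ0 : 0 ≤ κ) (hκ : κ * (‖V‖ + ‖w‖) < |(V * starRingEnd ℂ w).im|)
    (hneg : (V * starRingEnd ℂ w).im < 0) (hε : 0 < ε) (hεη : ε * ‖w‖ < η) :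
    wind (fun s => Λ s - (y + ε * w)) - wind (fun s => Λ s - (y - ε * w)) = 1 := by
  set ℓ := y + ε * w with hℓ
  set r := y - ε * w with hr
  -- points `y + μ w`, `|μ| ≤ ε`, lie on the loop only for `μ = 0`, at `σ₀`
  have key : ∀ s ∈ Icc (0 : ℝ) 1, ∀ μ : ℝ, |μ| ≤ ε → Λ s = y + μ * w → μ = 0 ∧ s = σ₀ := by
    intro s hs μ hμ h
    refine eq_of_loop_eq_add hcone hfar hκ hs (e := 0)
      (by rw [norm_zero]; exact mul_nonneg hκ0 (abs_nonneg μ)) ?_ (by rw [h, add_zero])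
    rw [add_zero, norm_mul, Complex.norm_real, Real.norm_eq_abs]
    exact (mul_le_mul_of_nonneg_right hμ (norm_nonneg w)).trans_lt hεη
  have hr' : r = y + ((-ε : ℝ) : ℂ) * w := by rw [hr]; push_cast; ring
  have hℓs : ∀ s ∈ Icc (0 : ℝ) 1, Λ s ≠ ℓ := fun s hs h =>
    hε.ne' (key s hs ε (by rw [abs_of_pos hε]) h).1
  have hrs : ∀ s ∈ Icc (0 : ℝ) 1, Λ s ≠ r := fun s hs h => by
    have := (key s hs (-ε) (by rw [abs_neg, abs_of_pos hε]) (by rw [h, hr'])).1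
    linarith
  -- on the segment `[ℓ, r]` only at `σ₀`
  have hseg : ∀ s ∈ Icc (0 : ℝ) 1, Λ s ∈ segment ℝ ℓ r → s = σ₀ := by
    intro s hs hmem
    obtain ⟨μ, hμ, hμe⟩ := exists_eq_add_mul_of_mem_segment hε.le hmem
    exact (key s hs μ hμ hμe).2
  -- logarithms
  have hΛc : ContinuousOn Λ (Icc 0 1) := hΛ.continuousOn
  have hlogℓ : HasLogOn (fun s => Λ s - ℓ) (Icc 0 1) :=
    hasLogOn_Icc (hΛc.sub continuousOn_const) fun s hs h0 => hℓs s hs (sub_eq_zero.1 h0)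
  have hlogr : HasLogOn (fun s => Λ s - r) (Icc 0 1) :=
    hasLogOn_Icc (hΛc.sub continuousOn_const) fun s hs h0 => hrs s hs (sub_eq_zero.1 h0)
  have hloopℓ : IsNonvanishingLoop fun s => Λ s - ℓ :=
    ⟨hΛc.sub continuousOn_const, fun s hs h0 => hℓs s hs (sub_eq_zero.1 h0), by rw [h01]⟩
  have hloopr : IsNonvanishingLoop fun s => Λ s - r :=
    ⟨hΛc.sub continuousOn_const, fun s hs h0 => hrs s hs (sub_eq_zero.1 h0), by rw [h01]⟩
  set g : ℝ → ℂ := fun s => crossRatioFn ℓ r (Λ s) with hg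
  have hg_def : g = fun s => (Λ s - ℓ) / (Λ s - r) := rfl
  have hlogg : HasLogOn g (Icc 0 1) := hlogℓ.div hlogr
  -- (1) the total increment is `2πi (wind ℓ - wind r)`
  have h1 : incrOn g 0 1 = (wind (fun s => Λ s - ℓ) - wind (fun s => Λ s - r)) * (2 * π * I) := by
    rw [hg_def, incrOn_div zero_le_one hlogℓ hlogr, incrOn_eq_wind_mul hloopℓ,
      incrOn_eq_wind_mul hloopr]
    ring
  -- (2) split at `σ₀ ± δ`
  have hα0 : (0 : ℝ) ≤ σ₀ - δ := by linarith
  have hβ1 : σ₀ + δ ≤ 1 := hσδ.le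
  have h2 : incrOn g 0 1 = incrOn g 0 (σ₀ - δ) + (incrOn g (σ₀ - δ) (σ₀ + δ) + incrOn g (σ₀ + δ) 1) := by
    rw [incrOn_add hα0 (by linarith) hlogg,
      incrOn_add (by linarith) hβ1 (hlogg.mono (Icc_subset_Icc_left hα0))]
  -- continuity of `g` on `[0, 1]`
  have hgc : ContinuousOn g (Icc 0 1) := by
    refine continuousOn_of_forall_continuousAt fun s hs => ?_
    exact (continuousAt_crossRatioFn (hrs s hs)).comp hΛ.continuousAt
  -- (3) off the window `g` stays in the slit plane
  have hslit : ∀ s ∈ Icc (0 : ℝ) 1, s ≠ σ₀ → g s ∈ slitPlane := fun s hs hne =>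
    crossRatioFn_mem_slitPlane fun hmem => hne (hseg s hs hmem)
  have h3 : incrOn g 0 (σ₀ - δ) = log (g (σ₀ - δ)) - log (g 0) :=
    incrOn_eq_log_sub_log hα0 (hgc.mono (Icc_subset_Icc_right (by linarith))) fun s hs =>
      hslit s ⟨hs.1, hs.2.trans (by linarith)⟩ (by intro h; rw [h] at hs; linarith [hs.2])
  have h4 : incrOn g (σ₀ + δ) 1 = log (g 1) - log (g (σ₀ + δ)) :=
    incrOn_eq_log_sub_log hβ1 (hgc.mono (Icc_subset_Icc_left (by linarith))) fun s hs =>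
      hslit s ⟨le_trans (by linarith) hs.1, hs.2⟩ (by intro h; rw [h] at hs; linarith [hs.1])
  -- (4) on the window: one transversal crossing
  have hside : ∀ s, |s - σ₀| ≤ δ → s ≠ σ₀ →
      (s < σ₀ → 0 < segSide ℓ r (Λ s)) ∧ (σ₀ < s → segSide ℓ r (Λ s) < 0) := by
    intro s hsδ hne
    set e' := Λ s - y - ((s - σ₀ : ℝ) : ℂ) * V with he'
    have hcs := hcone s hsδ
    have hΛs : Λ s = y + (((s - σ₀ : ℝ) : ℂ) * V + e') := by rw [he']; ring
    have hss : segSide ℓ r (Λ s) =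
        2 * ε * ((s - σ₀) * (V * starRingEnd ℂ w).im + (e' * starRingEnd ℂ w).im) := by
      rw [hΛs, hℓ, hr, segSide_add_sub]
      congr 1
      rw [add_mul, Complex.add_im, mul_assoc, Complex.im_ofReal_mul]
    have herr : |(e' * starRingEnd ℂ w).im| ≤ κ * |s - σ₀| * ‖w‖ :=
      (Complex.abs_im_le_norm _).trans (by
        rw [norm_mul, Complex.norm_conj]; exact mul_le_mul_of_nonneg_right hcs (norm_nonneg w))
    have hκw : κ * ‖w‖ < -(V * starRingEnd ℂ w).im := by
      have : |(V * starRingEnd ℂ w).im| = -(V * starRingEnd ℂ w).im := abs_of_neg hneg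
      nlinarith [mul_nonneg hκ0 (norm_nonneg V), norm_nonneg w]
    have habs := abs_le.1 herr
    constructor
    · intro hlt
      have hs' : |s - σ₀| = σ₀ - s := by rw [abs_of_neg (sub_neg.2 hlt)]; ring
      rw [hss]
      refine mul_pos (by positivity) ?_
      rw [hs'] at habs
      nlinarith [habs.1, habs.2, mul_pos (sub_pos.2 hlt) (sub_pos.2 hκw)]
    · intro hlt
      have hs' : |s - σ₀| = s - σ₀ := abs_of_pos (sub_pos.2 hlt)
      rw [hss]
      refine mul_neg_of_pos_of_neg (by positivity) ?_
      rw [hs'] at habs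
      nlinarith [habs.1, habs.2, mul_pos (sub_pos.2 hlt) (sub_pos.2 hκw)]
  have h5 : incrOn g (σ₀ - δ) (σ₀ + δ) = log (g (σ₀ + δ)) - log (g (σ₀ - δ)) + 2 * π * I := by
    refine incrOn_crossRatioFn_of_cross (τ := σ₀) (hΛc.mono (Icc_subset_Icc hα0 hβ1))
      (by linarith) (by linarith) (fun s hs => ?_) (fun s hs => ?_) ?_
    · have hsδ : |s - σ₀| ≤ δ := by rw [abs_le]; constructor <;> linarith [hs.1, hs.2]
      exact (hside s hsδ hs.2.ne).1 hs.2
    · have hsδ : |s - σ₀| ≤ δ := by rw [abs_le]; constructor <;> linarith [hs.1, hs.2]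
      exact (hside s hsδ hs.1.ne').2 hs.1
    · rw [hy]; exact mem_openSegment_add_sub y (ε * w)
  -- (5) assemble
  have hg01 : g 1 = g 0 := by simp only [hg, h01]
  have htot : incrOn g 0 1 = 1 * (2 * π * I) := by
    rw [h2, h3, h4, h5, hg01]; ring
  rw [h1] at htot
  exact_mod_cast int_eq_of_mul_two_pi_I_eq (by exact_mod_cast htot)

/-- **The corner.** Let the loop start and end at `y` with outgoing velocity `Va` at `s = 0` and
incoming velocity `Vb` at `s = 1`, transversal to each other, within cones as above. Then the
winding numbers of the loop about the two points `y + ε Vb + ep` (just *after* the corner along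
the direction `Vb`) and `y - ε Va + em` (just *before* it along `Va`) agree, for `ε > 0` small
and `‖e±‖ ≤ κ ε`: the straight segment between them misses the loop (it cuts the corner on the
side opposite to the wedge `{+Va, -Vb}` occupied by the loop). [folklore] -/
theorem wind_sub_eq_of_corner {Λ : ℝ → ℂ} {δ κ η ε : ℝ} {y Va Vb ep em : ℂ} (hΛ : Continuous Λ)
    (h0 : Λ 0 = y) (h1 : Λ 1 = y)
    (hcone0 : ∀ s, |s| ≤ δ → ‖Λ s - y - (s : ℂ) * Va‖ ≤ κ * |s|)
    (hcone1 : ∀ s, |s - 1| ≤ δ → ‖Λ s - y - ((s - 1 : ℝ) : ℂ) * Vb‖ ≤ κ * |s - 1|)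
    (hfar : ∀ s ∈ Icc (0 : ℝ) 1, δ ≤ s → s ≤ 1 - δ → η ≤ ‖Λ s - y‖)
    (hκ : κ * (‖Va‖ + ‖Vb‖) < |(Va * starRingEnd ℂ Vb).im|)
    (hε : 0 < ε) (hεη : ε * (‖Va‖ + ‖Vb‖ + κ) < η) (hep : ‖ep‖ ≤ κ * ε) (hem : ‖em‖ ≤ κ * ε) :
    wind (fun s => Λ s - (y + ε * Vb + ep)) = wind (fun s => Λ s - (y - ε * Va + em)) := by
  set zp := y + ε * Vb + ep with hzp
  set zm := y - ε * Va + em with hzm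
  set D := |(Va * starRingEnd ℂ Vb).im| with hD
  have hκ0 : 0 ≤ κ := by
    have := (norm_nonneg ep).trans hep
    nlinarith
  set c : ℝ → ℂ := fun μ => zp + (μ : ℂ) * (zm - zp) with hc
  have hc0 : c 0 = zp := by simp [hc]
  have hc1 : c 1 = zm := by simp [hc]
  have hcc : Continuous c := by simp only [hc]; fun_prop
  rw [← hc0, ← hc1]
  refine wind_sub_eq_of_path hΛ.continuousOn (h0.trans h1.symm) zero_le_one hcc.continuousOn
    fun μ hμ hmem => ?_
  obtain ⟨s, hs, hsμ⟩ := hmem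
  obtain ⟨hμ0, hμ1⟩ := hμ
  -- `c μ = y + ε ((1 - μ) Vb - μ Va) + err`, `‖err‖ ≤ κ ε`
  set err : ℂ := ((1 - μ : ℝ) : ℂ) * ep + (μ : ℂ) * em with herr
  have hcμ : c μ = y + ((ε * (1 - μ) : ℝ) : ℂ) * Vb - ((ε * μ : ℝ) : ℂ) * Va + err := by
    simp only [hc, hzp, hzm, herr]; push_cast; ring
  have herr_le : ‖err‖ ≤ κ * ε := by
    calc ‖err‖ ≤ ‖((1 - μ : ℝ) : ℂ) * ep‖ + ‖(μ : ℂ) * em‖ := norm_add_le _ _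
      _ = (1 - μ) * ‖ep‖ + μ * ‖em‖ := by
          rw [norm_mul, norm_mul, Complex.norm_real, Complex.norm_real, Real.norm_eq_abs,
            Real.norm_eq_abs, abs_of_nonneg (by linarith), abs_of_nonneg hμ0]
      _ ≤ (1 - μ) * (κ * ε) + μ * (κ * ε) :=
          add_le_add (mul_le_mul_of_nonneg_left hep (by linarith)) (mul_le_mul_of_nonneg_left hem hμ0)
      _ = κ * ε := by ring
  have hVa0 := norm_nonneg Va
  have hVb0 := norm_nonneg Vb
  by_cases hs0 : s < δ
  · -- near the start of the loop
    set e' := Λ s - y - (s : ℂ) * Va with he'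
    have hcs : ‖e'‖ ≤ κ * |s| := hcone0 s (by rw [abs_of_nonneg hs.1]; exact hs0.le)
    rw [abs_of_nonneg hs.1] at hcs
    have heq : ((s + ε * μ : ℝ) : ℂ) * Va + ((-(ε * (1 - μ)) : ℝ) : ℂ) * Vb = err - e' := by
      rw [he', hsμ, hcμ]; push_cast; ring
    obtain ⟨hA, hB⟩ := abs_mul_im_le_of_eq heq
    rw [abs_of_nonneg (add_nonneg hs.1 (mul_nonneg hε.le hμ0))] at hA
    rw [abs_neg, abs_of_nonneg (by nlinarith)] at hB
    have hE : ‖err - e'‖ ≤ κ * ε + κ * s := (norm_sub_le _ _).trans (add_le_add herr_le hcs)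
    have hsum : (s + ε) * D ≤ (s + ε) * (κ * (‖Va‖ + ‖Vb‖)) := by
      nlinarith [mul_le_mul_of_nonneg_right hE hVa0, mul_le_mul_of_nonneg_right hE hVb0]
    have := le_of_mul_le_mul_left hsum (by linarith [hs.1])
    linarith
  by_cases hs1 : 1 - δ < s
  · -- near the end of the loop
    set e' := Λ s - y - ((s - 1 : ℝ) : ℂ) * Vb with he'
    have hcs : ‖e'‖ ≤ κ * |s - 1| := hcone1 s (by rw [abs_le]; constructor <;> linarith [hs.2])
    rw [abs_of_nonpos (by linarith [hs.2])] at hcs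
    have heq : ((ε * μ : ℝ) : ℂ) * Va + ((s - 1 - ε * (1 - μ) : ℝ) : ℂ) * Vb = err - e' := by
      rw [he', hsμ, hcμ]; push_cast; ring
    obtain ⟨hA, hB⟩ := abs_mul_im_le_of_eq heq
    rw [abs_of_nonneg (mul_nonneg hε.le hμ0)] at hA
    rw [abs_of_nonpos (by nlinarith [hs.2])] at hB
    have hE : ‖err - e'‖ ≤ κ * ε + κ * (1 - s) := by
      refine (norm_sub_le _ _).trans (add_le_add herr_le ?_); linarith
    have hsum : (1 - s + ε) * D ≤ (1 - s + ε) * (κ * (‖Va‖ + ‖Vb‖)) := by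
      nlinarith [mul_le_mul_of_nonneg_right hE hVa0, mul_le_mul_of_nonneg_right hE hVb0]
    have := le_of_mul_le_mul_left hsum (by linarith [hs.2])
    linarith
  · -- far from the corner
    have hf := hfar s hs (not_lt.1 hs0) (not_lt.1 hs1)
    rw [hsμ, hcμ] at hf
    have : ‖y + ((ε * (1 - μ) : ℝ) : ℂ) * Vb - ((ε * μ : ℝ) : ℂ) * Va + err - y‖ ≤
        ε * (‖Va‖ + ‖Vb‖ + κ) := by
      have e1 : y + ((ε * (1 - μ) : ℝ) : ℂ) * Vb - ((ε * μ : ℝ) : ℂ) * Va + err - y =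
          ((ε * (1 - μ) : ℝ) : ℂ) * Vb + (-(((ε * μ : ℝ) : ℂ) * Va)) + err := by ring
      rw [e1]
      refine (norm_add₃_le).trans ?_
      rw [norm_neg, norm_mul, norm_mul, Complex.norm_real, Complex.norm_real, Real.norm_eq_abs,
        Real.norm_eq_abs, abs_of_nonneg (by nlinarith), abs_of_nonneg (mul_nonneg hε.le hμ0)]
      nlinarith [mul_nonneg hε.le hVa0, mul_nonneg hε.le hVb0]
    linarith

end Literature.Topology.FourManifolds.GaussParity

namespace Literature.Topology.FourManifolds

open Literature.Topology.PlaneTopology GaussParity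

namespace Knot

/-! ### The plane curve of a knot as a complex-valued function -/

/-- The plane curve of a knot read in `ℂ` (`(x, y) ↦ x + iy`). [folklore] -/
def cplaneCurve (K : Knot) (t : ℝ) : ℂ := Complex.equivRealProdCLM.symm (K.planeCurve t)

/-- The velocity of the plane curve of a knot read in `ℂ`. [folklore] -/
def cplaneDeriv (K : Knot) (t : ℝ) : ℂ := Complex.equivRealProdCLM.symm (deriv K.planeCurve t)

/-- The complex plane curve is `2π`-periodic. [folklore] -/
theorem periodic_cplaneCurve (K : Knot) : Function.Periodic K.cplaneCurve (2 * π) := fun t => by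
  simp only [cplaneCurve, K.periodic_planeCurve t]

/-- The complex velocity is `2π`-periodic (no differentiability needed: `deriv` of a translate).
[folklore] -/
theorem periodic_cplaneDeriv (K : Knot) : Function.Periodic K.cplaneDeriv (2 * π) := fun t => by
  simp only [cplaneDeriv]
  congr 1
  have h : (fun x => K.planeCurve (x + 2 * π)) = K.planeCurve := funext K.periodic_planeCurve
  conv_rhs => rw [← h]
  rw [deriv_comp_add_const]

/-- Two parameters have the same complex point iff they have the same point of the plane curve.
[folklore] -/
theorem cplaneCurve_eq_iff (K : Knot) {s t : ℝ} :
    K.cplaneCurve s = K.cplaneCurve t ↔ K.planeCurve s = K.planeCurve t :=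
  Complex.equivRealProdCLM.symm.injective.eq_iff

/-- `Im (v w̄)` for plane vectors read in `ℂ` is minus the determinant `det (v, w)`. [folklore] -/
theorem im_mul_conj_equivRealProdCLM_symm (v w : ℝ × ℝ) :
    (Complex.equivRealProdCLM.symm v * starRingEnd ℂ (Complex.equivRealProdCLM.symm w)).im =
      v.2 * w.1 - v.1 * w.2 := by
  simp [Complex.mul_im]
  ring

namespace RegularProjection

variable {K : Knot} (P : K.RegularProjection)

/-- In a regular projection the plane curve is differentiable everywhere (its `deriv` is nowhere
zero), with complex velocity `cplaneDeriv`. [folklore] -/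
theorem hasDerivAt_cplaneCurve (P : K.RegularProjection) (t : ℝ) :
    HasDerivAt K.cplaneCurve (K.cplaneDeriv t) t := by
  have hd : HasDerivAt K.planeCurve (deriv K.planeCurve t) t :=
    (differentiableAt_of_deriv_ne_zero (P.deriv_ne_zero t)).hasDerivAt
  exact (Complex.equivRealProdCLM.symm : ℝ × ℝ →L[ℝ] ℂ).hasFDerivAt.comp_hasDerivAt t hd

/-- In a regular projection the complex plane curve is continuous. [folklore] -/
theorem continuous_cplaneCurve (P : K.RegularProjection) : Continuous K.cplaneCurve :=
  continuous_iff_continuousAt.2 fun t => (P.hasDerivAt_cplaneCurve t).continuousAt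

/-- In a regular projection the complex velocity never vanishes. [folklore] -/
theorem cplaneDeriv_ne_zero (P : K.RegularProjection) (t : ℝ) : K.cplaneDeriv t ≠ 0 := fun h =>
  P.deriv_ne_zero t (Complex.equivRealProdCLM.symm.injective (by
    rw [map_zero]; exact h))

/-- **Transversality in complex form**: at every crossing `Im (γ'(over) · conj γ'(under)) ≠ 0`.
[folklore] -/
theorem im_mul_conj_ne_zero (i : Fin P.diagram.n) :
    (K.cplaneDeriv (P.θ (P.diagram.overPos i)) *
      starRingEnd ℂ (K.cplaneDeriv (P.θ (P.diagram.underPos i)))).im ≠ 0 := by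
  have hd := P.det_ne_zero i
  rw [Matrix.det_fin_two_of] at hd
  simp only [cplaneDeriv, im_mul_conj_equivRealProdCLM_symm]
  intro h
  apply hd
  linarith

/-! ### Angle bookkeeping: parameters of the marked points modulo `2π` -/

/-- Two marked-point parameters differing by a multiple of `2π` are equal (all parameters lie in
one period). [folklore] -/
theorem int_eq_zero_of_θ_add (r e : Fin (2 * P.diagram.n)) {k : ℤ}
    (h : P.θ r + k * (2 * π) = P.θ e) : k = 0 := by
  have h1 := P.lt_add_two_pi r e
  have h2 := P.lt_add_two_pi e r
  have hk1 : (k : ℝ) < 1 := by nlinarith [Real.pi_pos]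
  have hk2 : (-1 : ℝ) < k := by nlinarith [Real.pi_pos]
  have hk1' : k < 1 := by exact_mod_cast hk1
  have hk2' : -1 < k := by exact_mod_cast hk2
  omega

/-- A parameter of a marked point, shifted by a multiple of `2π`, lies in the parameter window
`[θ a, θ b]` only unshifted, and then the point lies between `a` and `b`. [folklore] -/
theorem mem_Icc_of_θ_add_mem_Icc {a b r : Fin (2 * P.diagram.n)} {k : ℤ}
    (h : P.θ r + k * (2 * π) ∈ Icc (P.θ a) (P.θ b)) : k = 0 ∧ a ≤ r ∧ r ≤ b := by
  obtain ⟨h1, h2⟩ := h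
  have h3 := P.lt_add_two_pi b r
  have h4 := P.lt_add_two_pi r a
  have hk1 : (k : ℝ) < 1 := by nlinarith [Real.pi_pos]
  have hk2 : (-1 : ℝ) < k := by nlinarith [Real.pi_pos]
  have hk1' : k < 1 := by exact_mod_cast hk1
  have hk2' : -1 < k := by exact_mod_cast hk2
  obtain rfl : k = 0 := by omega
  simp only [Int.cast_zero, zero_mul, add_zero] at h1 h2
  exact ⟨rfl, P.strictMono.le_iff_le.1 h1, P.strictMono.le_iff_le.1 h2⟩

/-- A parameter of a marked point, shifted by a multiple of `2π`, lies in the complementary window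
`(θ b, θ a + 2π)` only if it is `θ r` with `b < r` or `θ r + 2π` with `r < a`. [folklore] -/
theorem of_θ_add_mem_Ioo {a b r : Fin (2 * P.diagram.n)} {k : ℤ}
    (h : P.θ r + k * (2 * π) ∈ Ioo (P.θ b) (P.θ a + 2 * π)) :
    (k = 0 ∧ b < r) ∨ (k = 1 ∧ r < a) := by
  obtain ⟨h1, h2⟩ := h
  have h3 := P.lt_add_two_pi r b
  have h4 := P.lt_add_two_pi a r
  have hk1 : (k : ℝ) < 2 := by nlinarith [Real.pi_pos]
  have hk2 : (-1 : ℝ) < k := by nlinarith [Real.pi_pos]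
  have hk1' : k < 2 := by exact_mod_cast hk1
  have hk2' : -1 < k := by exact_mod_cast hk2
  rcases (show k = 0 ∨ k = 1 by omega) with rfl | rfl
  · left
    simp only [Int.cast_zero, zero_mul, add_zero] at h1
    exact ⟨rfl, P.strictMono.lt_iff_lt.1 h1⟩
  · right
    simp only [Int.cast_one, one_mul, add_lt_add_iff_right] at h2
    exact ⟨rfl, P.strictMono.lt_iff_lt.1 h2⟩

/-- The partner of an over-passage parameterises the same double point. [folklore] -/
theorem cplaneCurve_θ_partner (r : Fin (2 * P.diagram.n)) :
    K.cplaneCurve (P.θ (P.diagram.partner r)) = K.cplaneCurve (P.θ r) := by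
  rw [cplaneCurve_eq_iff]
  obtain ⟨j, rfl | rfl⟩ := P.diagram.exists_chord r
  · rw [GaussDiagram.partner_overPos]; exact (P.double j).symm
  · rw [GaussDiagram.partner_underPos]; exact P.double j

/-- From a two-element set equation `{A, B} = {C, D}` with `C ≠ D`: `B = C` and `A = D`, or
`B = D` and `A = C`. [folklore] -/
theorem pair_eq_pair {A B C D : ℝ} (h : ({A, B} : Set ℝ) = {C, D}) (hCD : C ≠ D) :
    (A = C ∧ B = D) ∨ (A = D ∧ B = C) := by
  have hA : A ∈ ({C, D} : Set ℝ) := h ▸ mem_insert A {B}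
  have hB : B ∈ ({C, D} : Set ℝ) := h ▸ mem_insert_of_mem A rfl
  have hC : C ∈ ({A, B} : Set ℝ) := h.symm ▸ mem_insert C {D}
  have hD : D ∈ ({A, B} : Set ℝ) := h.symm ▸ mem_insert_of_mem C rfl
  simp only [mem_insert_iff, mem_singleton_iff] at hA hB hC hD
  rcases hA with rfl | rfl <;> rcases hB with rfl | rfl
  · rcases hD with h | h <;> exact (hCD h.symm).elim
  · exact Or.inl ⟨rfl, rfl⟩
  · exact Or.inr ⟨rfl, rfl⟩
  · rcases hC with h | h <;> exact (hCD h).elim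

/-- **The double-point dictionary.** If the curve passes at parameter `s` through the point of the
marked point `r`, then `s` is, modulo `2π`, the parameter of `r` or of its partner. [folklore] -/
theorem eq_θ_or_eq_θ_partner {s : ℝ} {r : Fin (2 * P.diagram.n)}
    (h : K.cplaneCurve s = K.cplaneCurve (P.θ r)) :
    ∃ k : ℤ, s = P.θ r + k * (2 * π) ∨ s = P.θ (P.diagram.partner r) + k * (2 * π) := by
  rw [cplaneCurve_eq_iff] at h
  rcases P.eq_or_crossing (P.θ r) s h.symm with ⟨k, hk⟩ | ⟨j, k, l, hset⟩
  · exact ⟨k, Or.inl hk⟩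
  · have hne : P.θ (P.diagram.overPos j) ≠ P.θ (P.diagram.underPos j) := fun he =>
      P.diagram.overPos_ne_underPos j j (P.injective_θ he)
    rcases pair_eq_pair hset hne with ⟨h1, h2⟩ | ⟨h1, h2⟩
    · obtain rfl := P.int_eq_zero_of_θ_add r _ h1
      simp only [Int.cast_zero, zero_mul, add_zero] at h1
      have hr : r = P.diagram.overPos j := P.injective_θ h1
      refine ⟨-l, Or.inr ?_⟩
      rw [hr, GaussDiagram.partner_overPos, ← h2]
      push_cast
      ring
    · obtain rfl := P.int_eq_zero_of_θ_add r _ h1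
      simp only [Int.cast_zero, zero_mul, add_zero] at h1
      have hr : r = P.diagram.underPos j := P.injective_θ h1
      refine ⟨-l, Or.inr ?_⟩
      rw [hr, GaussDiagram.partner_underPos, ← h2]
      push_cast
      ring

/-! ### The loop cut off by a chord and the winding number about the moving point -/

section Loop

variable (a b : Fin (2 * P.diagram.n))

/-- The affine reparametrisation `[0, 1] → [θ a, θ b]`. [folklore] -/
def loopParam (s : ℝ) : ℝ := P.θ a + s * (P.θ b - P.θ a)

/-- The **loop cut off by the chord `{a, b}`**: the plane curve on `[θ a, θ b]`, read on `[0, 1]`.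
[folklore] -/
def loopCurve (s : ℝ) : ℂ := K.cplaneCurve (P.loopParam a b s)

/-- The **winding number of the loop** cut off by `{a, b}` **about the moving point** `γ t` of the
curve. [folklore] -/
def windAt (t : ℝ) : ℤ := wind fun s => P.loopCurve a b s - K.cplaneCurve t

/-- The parameter in the complementary window `(θ b, θ a + 2π)` at which the curve passes through
the marked point `q` (for `q` outside `[a, b]`; it depends on `b` only). [folklore] -/
def crossTime (b q : Fin (2 * P.diagram.n)) : ℝ := if b < q then P.θ q else P.θ q + 2 * π

/-- The marked points outside `[a, b]` whose partner lies strictly between `a` and `b`: the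
passages of the complementary arc through the double points of the loop (one for each chord
interlaced with `{a, b}`). [folklore] -/
def crossSet : Finset (Fin (2 * P.diagram.n)) :=
  Finset.univ.filter fun q => ¬ (a ≤ q ∧ q ≤ b) ∧ (a < P.diagram.partner q ∧ P.diagram.partner q < b)

variable {a b}

/-- The reparametrisation starts at `θ a`. [folklore] -/
@[simp] theorem loopParam_zero : P.loopParam a b 0 = P.θ a := by simp [loopParam]

/-- The reparametrisation ends at `θ b`. [folklore] -/
@[simp] theorem loopParam_one : P.loopParam a b 1 = P.θ b := by simp [loopParam]

/-- `θ a < θ b` for `a < b`. [folklore] -/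
theorem θ_lt_θ (hab : a < b) : P.θ a < P.θ b := P.strictMono hab

/-- The reparametrisation maps `[0, 1]` into `[θ a, θ b]`. [folklore] -/
theorem loopParam_mem_Icc (hab : a < b) {s : ℝ} (hs : s ∈ Icc (0 : ℝ) 1) :
    P.loopParam a b s ∈ Icc (P.θ a) (P.θ b) := by
  have h := P.θ_lt_θ hab
  obtain ⟨h0, h1⟩ := hs
  constructor
  · simp only [loopParam]; nlinarith
  · simp only [loopParam]; nlinarith

/-- The reparametrisation is strictly increasing. [folklore] -/
theorem strictMono_loopParam (hab : a < b) : StrictMono (P.loopParam a b) := fun s t hst => by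
  have h := P.θ_lt_θ hab
  simp only [loopParam]
  nlinarith

/-- The reparametrisation maps `[0, 1]` onto `[θ a, θ b]`. [folklore] -/
theorem exists_loopParam_eq (hab : a < b) {x : ℝ} (hx : x ∈ Icc (P.θ a) (P.θ b)) :
    ∃ s ∈ Icc (0 : ℝ) 1, P.loopParam a b s = x := by
  have h := P.θ_lt_θ hab
  refine ⟨(x - P.θ a) / (P.θ b - P.θ a), ⟨div_nonneg (by linarith [hx.1]) (by linarith),
    (div_le_one (by linarith)).2 (by linarith [hx.2])⟩, ?_⟩
  simp only [loopParam]
  rw [div_mul_cancel₀ _ (ne_of_gt (sub_pos.2 h))]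
  ring

/-- The trace of the loop is the trace of the curve on `[θ a, θ b]`. [folklore] -/
theorem image_loopCurve (hab : a < b) :
    P.loopCurve a b '' Icc 0 1 = K.cplaneCurve '' Icc (P.θ a) (P.θ b) := by
  ext z
  simp only [mem_image, loopCurve]
  constructor
  · rintro ⟨s, hs, rfl⟩
    exact ⟨_, P.loopParam_mem_Icc hab hs, rfl⟩
  · rintro ⟨x, hx, rfl⟩
    obtain ⟨s, hs, hsx⟩ := P.exists_loopParam_eq hab hx
    exact ⟨s, hs, by rw [hsx]⟩

/-- The derivative of the reparametrisation. [folklore] -/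
theorem hasDerivAt_loopParam (s : ℝ) : HasDerivAt (P.loopParam a b) (P.θ b - P.θ a) s := by
  have h := ((hasDerivAt_id s).mul_const (P.θ b - P.θ a)).const_add (P.θ a)
  rw [one_mul] at h
  exact h

/-- The velocity of the loop. [folklore] -/
theorem hasDerivAt_loopCurve (s : ℝ) : HasDerivAt (P.loopCurve a b)
    (((P.θ b - P.θ a : ℝ) : ℂ) * K.cplaneDeriv (P.loopParam a b s)) s := by
  have h := (P.hasDerivAt_cplaneCurve (P.loopParam a b s)).scomp s (P.hasDerivAt_loopParam s)
  rwa [Complex.real_smul] at h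

/-- The loop is continuous. [folklore] -/
theorem continuous_loopCurve : Continuous (P.loopCurve a b) :=
  continuous_iff_continuousAt.2 fun s => (P.hasDerivAt_loopCurve s).continuousAt

/-- The loop starts at the point of `a`. [folklore] -/
@[simp] theorem loopCurve_zero : P.loopCurve a b 0 = K.cplaneCurve (P.θ a) := by simp [loopCurve]

/-- The loop ends at the point of `b`. [folklore] -/
@[simp] theorem loopCurve_one : P.loopCurve a b 1 = K.cplaneCurve (P.θ b) := by simp [loopCurve]

/-- The loop closes up: `a` and `b = partner a` parameterise the same double point. [folklore] -/
theorem loopCurve_zero_eq_one (hpa : P.diagram.partner a = b) : P.loopCurve a b 0 = P.loopCurve a b 1 := by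
  rw [loopCurve_zero, loopCurve_one, ← hpa, cplaneCurve_θ_partner]

/-- If `b` is the partner of `a` then `a` is the partner of `b`. [folklore] -/
theorem partner_eq_of_partner_eq (hpa : P.diagram.partner a = b) : P.diagram.partner b = a := by
  rw [← hpa, GaussDiagram.partner_partner]

/-- Cross times lie in the complementary window. [folklore] -/
theorem crossTime_mem_Ioo {q : Fin (2 * P.diagram.n)} (hq : ¬ (a ≤ q ∧ q ≤ b)) :
    P.crossTime b q ∈ Ioo (P.θ b) (P.θ a + 2 * π) := by
  unfold crossTime
  split_ifs with h
  · exact ⟨P.strictMono h, P.lt_add_two_pi q a⟩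
  · have hqa : q < a := by
      by_contra h'
      exact hq ⟨not_lt.1 h', not_lt.1 h⟩
    exact ⟨P.lt_add_two_pi b q, by linarith [P.strictMono hqa]⟩

/-- Membership in `crossSet`. [folklore] -/
theorem mem_crossSet {q : Fin (2 * P.diagram.n)} : q ∈ P.crossSet a b ↔
    ¬ (a ≤ q ∧ q ≤ b) ∧ (a < P.diagram.partner q ∧ P.diagram.partner q < b) := by
  simp [crossSet]

/-- The curve passes at a cross time through the corresponding marked point. [folklore] -/
theorem cplaneCurve_crossTime (q : Fin (2 * P.diagram.n)) :
    K.cplaneCurve (P.crossTime b q) = K.cplaneCurve (P.θ q) := by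
  unfold crossTime
  split_ifs
  · rfl
  · exact K.periodic_cplaneCurve _

/-- **Where the complementary arc meets the loop.** A parameter `t` of the complementary window
`(θ b, θ a + 2π)` at which the curve lies on the loop `γ([θ a, θ b])` is the cross time of a
marked point of `crossSet`: by `eq_or_crossing` the coincidence `γ t = γ s` is a listed double
point `{s, t} ≡ {θ e', θ e} (mod 2π)` with `e` outside `[a, b]` and `e' = partner e` strictly
inside. [folklore] -/
theorem exists_eq_crossTime (hab : a < b) (hpa : P.diagram.partner a = b) {t : ℝ}
    (ht : t ∈ Ioo (P.θ b) (P.θ a + 2 * π))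
    (hmem : K.cplaneCurve t ∈ K.cplaneCurve '' Icc (P.θ a) (P.θ b)) :
    ∃ q ∈ P.crossSet a b, t = P.crossTime b q := by
  obtain ⟨s, hs, hst⟩ := hmem
  rw [cplaneCurve_eq_iff] at hst
  rcases P.eq_or_crossing s t hst with ⟨k, hk⟩ | ⟨j, k, l, hset⟩
  · -- `t ≡ s (mod 2π)` is impossible: `0 < t - s < 2π`
    exfalso
    obtain ⟨hs1, hs2⟩ := hs
    obtain ⟨ht1, ht2⟩ := ht
    have hk1 : (0 : ℝ) < k := by nlinarith [Real.pi_pos]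
    have hk2 : (k : ℝ) < 1 := by nlinarith [Real.pi_pos]
    have hk1' : 0 < k := by exact_mod_cast hk1
    have hk2' : k < 1 := by exact_mod_cast hk2
    omega
  · have hne : P.θ (P.diagram.overPos j) ≠ P.θ (P.diagram.underPos j) := fun he =>
      P.diagram.overPos_ne_underPos j j (P.injective_θ he)
    -- `t + 2πl = θ e`, `s + 2πk = θ (partner e)` for an end `e` of chord `j`
    obtain ⟨e, hte, hse⟩ : ∃ e : Fin (2 * P.diagram.n), t + l * (2 * π) = P.θ e ∧
        s + k * (2 * π) = P.θ (P.diagram.partner e) := by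
      rcases pair_eq_pair hset hne with ⟨h1, h2⟩ | ⟨h1, h2⟩
      · exact ⟨P.diagram.underPos j, h2, by rw [GaussDiagram.partner_underPos]; exact h1⟩
      · exact ⟨P.diagram.overPos j, h2, by rw [GaussDiagram.partner_overPos]; exact h1⟩
    have ht' : P.θ e + (-l : ℤ) * (2 * π) ∈ Ioo (P.θ b) (P.θ a + 2 * π) := by
      have : P.θ e + (-l : ℤ) * (2 * π) = t := by rw [← hte]; push_cast; ring
      rw [this]; exact ht
    have hs' : P.θ (P.diagram.partner e) + (-k : ℤ) * (2 * π) ∈ Icc (P.θ a) (P.θ b) := by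
      have : P.θ (P.diagram.partner e) + (-k : ℤ) * (2 * π) = s := by rw [← hse]; push_cast; ring
      rw [this]; exact hs
    obtain ⟨-, hae, heb⟩ := P.mem_Icc_of_θ_add_mem_Icc hs'
    have hpb := P.partner_eq_of_partner_eq hpa
    rcases P.of_θ_add_mem_Ioo ht' with ⟨hl0, hbe⟩ | ⟨hl1, hea⟩
    · refine ⟨e, P.mem_crossSet.2 ⟨fun h => absurd h.2 (not_le.2 hbe), ?_, ?_⟩, ?_⟩
      · refine lt_of_le_of_ne hae fun h => ?_
        have : e = b := by rw [← P.diagram.partner_partner e, ← h, hpa]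
        rw [this] at hbe
        exact lt_irrefl _ hbe
      · refine lt_of_le_of_ne heb fun h => ?_
        have : e = a := by rw [← P.diagram.partner_partner e, h, hpb]
        rw [this] at hbe
        exact lt_asymm hab hbe
      · have hl : l = 0 := by omega
        subst hl
        simp only [crossTime, if_pos hbe]
        simpa using hte
    · have hbe : ¬ b < e := not_lt.2 (hea.trans hab).le
      refine ⟨e, P.mem_crossSet.2 ⟨fun h => absurd h.1 (not_le.2 hea), ?_, ?_⟩, ?_⟩
      · refine lt_of_le_of_ne hae fun h => ?_
        have : e = b := by rw [← P.diagram.partner_partner e, ← h, hpa]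
        rw [this] at hea
        exact lt_asymm hab hea
      · refine lt_of_le_of_ne heb fun h => ?_
        have : e = a := by rw [← P.diagram.partner_partner e, h, hpb]
        rw [this] at hea
        exact lt_irrefl _ hea
      · have hl : l = -1 := by omega
        subst hl
        simp only [crossTime, if_neg hbe]
        push_cast at hte
        linarith

/-- **The winding number about the moving point is locally constant** between cross times.
[folklore] -/
theorem windAt_eq_windAt (hab : a < b) (hpa : P.diagram.partner a = b) {t₁ t₂ : ℝ} (h12 : t₁ ≤ t₂)
    (hI : Icc t₁ t₂ ⊆ Ioo (P.θ b) (P.θ a + 2 * π))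
    (hno : ∀ q ∈ P.crossSet a b, P.crossTime b q ∉ Icc t₁ t₂) :
    P.windAt a b t₁ = P.windAt a b t₂ := by
  unfold windAt
  refine wind_sub_eq_of_path P.continuous_loopCurve.continuousOn (P.loopCurve_zero_eq_one hpa)
    h12 P.continuous_cplaneCurve.continuousOn fun t ht hmem => ?_
  rw [P.image_loopCurve hab] at hmem
  obtain ⟨q, hq, rfl⟩ := P.exists_eq_crossTime hab hpa (hI ht) hmem
  exact hno q hq ht

end Loop

/-! ### The jump of the winding number at a cross time, and the corner -/

section Jump

variable {a b : Fin (2 * P.diagram.n)}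

/-- The complex velocity at a cross time is the velocity at the marked point. [folklore] -/
theorem cplaneDeriv_crossTime (q : Fin (2 * P.diagram.n)) :
    K.cplaneDeriv (P.crossTime b q) = K.cplaneDeriv (P.θ q) := by
  unfold crossTime
  split_ifs
  · rfl
  · exact K.periodic_cplaneDeriv _

/-- Transversality at the double point of `r` and its partner. [folklore] -/
theorem im_mul_conj_partner_ne_zero (r : Fin (2 * P.diagram.n)) :
    (K.cplaneDeriv (P.θ (P.diagram.partner r)) * starRingEnd ℂ (K.cplaneDeriv (P.θ r))).im ≠ 0 := by
  obtain ⟨j, rfl | rfl⟩ := P.diagram.exists_chord r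
  · rw [GaussDiagram.partner_overPos]
    have h := P.im_mul_conj_ne_zero j
    rw [← Complex.conj_conj (K.cplaneDeriv (P.θ (P.diagram.overPos j)) * _), map_mul,
      Complex.conj_conj, mul_comm, Complex.conj_im] at h
    exact fun h' => h (by rw [h', neg_zero])
  · rw [GaussDiagram.partner_underPos]
    exact P.im_mul_conj_ne_zero j

/-- The only parameter of `[0, 1]` at which the loop passes through the double point of an
interlaced chord is the parameter of its inner end. [folklore] -/
theorem loopCurve_eq_inner_iff (hab : a < b) {q : Fin (2 * P.diagram.n)} (hq : q ∈ P.crossSet a b)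
    {s : ℝ} (hs : s ∈ Icc (0 : ℝ) 1)
    (h : P.loopCurve a b s = K.cplaneCurve (P.θ (P.diagram.partner q))) :
    P.loopParam a b s = P.θ (P.diagram.partner q) := by
  obtain ⟨hqout, -, -⟩ := P.mem_crossSet.1 hq
  obtain ⟨k, hk | hk⟩ := P.eq_θ_or_eq_θ_partner h
  · have hmem : P.θ (P.diagram.partner q) + k * (2 * π) ∈ Icc (P.θ a) (P.θ b) :=
      hk ▸ P.loopParam_mem_Icc hab hs
    obtain ⟨rfl, -, -⟩ := P.mem_Icc_of_θ_add_mem_Icc hmem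
    simpa using hk
  · rw [GaussDiagram.partner_partner] at hk
    have hmem : P.θ q + k * (2 * π) ∈ Icc (P.θ a) (P.θ b) := hk ▸ P.loopParam_mem_Icc hab hs
    obtain ⟨-, h1, h2⟩ := P.mem_Icc_of_θ_add_mem_Icc hmem
    exact absurd ⟨h1, h2⟩ hqout

/-- **The jump at a cross time.** At the cross time `t₀` of an interlaced chord the winding number
of the loop about the moving point `γ t` jumps by `±1`: `W(t₀ + ε) - W(t₀ - ε) = ±1` for all
small `ε > 0`. [folklore] -/
theorem windAt_crossTime_add_sub (hab : a < b) (hpa : P.diagram.partner a = b)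
    {q : Fin (2 * P.diagram.n)} (hq : q ∈ P.crossSet a b) :
    ∀ᶠ ε in 𝓝[>] (0 : ℝ),
      P.windAt a b (P.crossTime b q + ε) - P.windAt a b (P.crossTime b q - ε) = 1 ∨
      P.windAt a b (P.crossTime b q + ε) - P.windAt a b (P.crossTime b q - ε) = -1 := by
  obtain ⟨hqout, hap, hpb⟩ := P.mem_crossSet.1 hq
  set p := P.diagram.partner q with hp_def
  have hc : 0 < P.θ b - P.θ a := sub_pos.2 (P.θ_lt_θ hab)
  set c := P.θ b - P.θ a with hc_def
  -- the loop parameter of the double point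
  set σ₀ := (P.θ p - P.θ a) / c with hσ₀_def
  have hθp1 : P.θ a < P.θ p := P.strictMono hap
  have hθp2 : P.θ p < P.θ b := P.strictMono hpb
  have hσ₀0 : 0 < σ₀ := div_pos (sub_pos.2 hθp1) hc
  have hσ₀1 : σ₀ < 1 := (div_lt_one hc).2 (by linarith)
  have hparam : P.loopParam a b σ₀ = P.θ p := by
    simp only [loopParam, hσ₀_def]
    rw [div_mul_cancel₀ _ hc.ne']
    ring
  set Λ := P.loopCurve a b with hΛ_def
  set y := K.cplaneCurve (P.θ p) with hy_def
  have hΛσ₀ : Λ σ₀ = y := by simp only [hΛ_def, loopCurve, hparam, hy_def]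
  set t₀ := P.crossTime b q with ht₀_def
  have hγt₀ : K.cplaneCurve t₀ = y := by
    rw [ht₀_def, cplaneCurve_crossTime, hy_def, hp_def, cplaneCurve_θ_partner]
  set V := (c : ℂ) * K.cplaneDeriv (P.θ p) with hV_def
  set w := K.cplaneDeriv (P.θ q) with hw_def
  have hΛd : HasDerivAt Λ V σ₀ := by
    have := P.hasDerivAt_loopCurve (a := a) (b := b) σ₀
    rwa [hparam] at this
  have hγd : HasDerivAt K.cplaneCurve w t₀ := by
    have := P.hasDerivAt_cplaneCurve t₀
    rwa [ht₀_def, cplaneDeriv_crossTime] at this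
  have hD : (V * starRingEnd ℂ w).im ≠ 0 := by
    rw [hV_def, mul_assoc, Complex.im_ofReal_mul]
    exact mul_ne_zero hc.ne' (hp_def ▸ P.im_mul_conj_partner_ne_zero q)
  -- constants
  set D := |(V * starRingEnd ℂ w).im| with hD_def
  have hD0 : 0 < D := abs_pos.2 hD
  set κ := D / (2 * (‖V‖ + ‖w‖ + 1)) with hκ_def
  have hnn : 0 < ‖V‖ + ‖w‖ + 1 := by positivity
  have hκ0 : 0 < κ := by positivity
  have hκ : κ * (‖V‖ + ‖w‖) < D := by
    have h1 : κ * (‖V‖ + ‖w‖ + 1) = D / 2 := by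
      rw [hκ_def]; field_simp
    nlinarith
  obtain ⟨δ₁, hδ₁, hcone₁⟩ := hΛd.exists_cone hκ0
  obtain ⟨δ₂, hδ₂, hcone₂⟩ := hγd.exists_cone hκ0
  set δ := min (δ₁ / 2) (min (σ₀ / 2) ((1 - σ₀) / 2)) with hδ_def
  have hδ0 : 0 < δ := by
    simp only [hδ_def, lt_min_iff]; exact ⟨by linarith, by linarith, by linarith⟩
  have hδδ₁ : δ < δ₁ := (min_le_left _ _).trans_lt (by linarith)
  have hδσ : δ < σ₀ := ((min_le_right _ _).trans (min_le_left _ _)).trans_lt (by linarith)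
  have hσδ : σ₀ + δ < 1 := by
    have := (min_le_right (δ₁ / 2) _).trans (min_le_right (σ₀ / 2) ((1 - σ₀) / 2))
    linarith
  have hcone : ∀ s, |s - σ₀| ≤ δ → ‖Λ s - y - ((s - σ₀ : ℝ) : ℂ) * V‖ ≤ κ * |s - σ₀| :=
    fun s hs => by rw [← hΛσ₀]; exact hcone₁ s (hs.trans_lt hδδ₁)
  -- far from the double point the loop stays away from it
  have huniq : ∀ s ∈ Icc (0 : ℝ) 1, Λ s = y → s = σ₀ := fun s hs h =>
    (P.strictMono_loopParam hab).injective
      ((P.loopCurve_eq_inner_iff hab hq hs h).trans hparam.symm)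
  obtain ⟨η, hη, hfar'⟩ := exists_pos_forall_le_norm_sub
    (S := Icc (0 : ℝ) 1 ∩ {s | δ ≤ |s - σ₀|})
    (isCompact_Icc.inter_right (isClosed_le continuous_const (by fun_prop)))
    (P.continuous_loopCurve.continuousOn) (y := y) (fun s hs h => by
      have h2 : δ ≤ |s - σ₀| := hs.2
      rw [huniq s hs.1 h, sub_self, abs_zero] at h2
      exact absurd h2 (not_le.2 hδ0))
  have hfar : ∀ s ∈ Icc (0 : ℝ) 1, δ ≤ |s - σ₀| → η ≤ ‖Λ s - y‖ := fun s hs hsδ =>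
    hfar' s ⟨hs, hsδ⟩
  -- small `ε`
  set ε₀ := min δ₂ (η / (‖w‖ + κ + 1)) with hε₀_def
  have hwκ : 0 < ‖w‖ + κ + 1 := by positivity
  have hε₀ : 0 < ε₀ := lt_min hδ₂ (div_pos hη hwκ)
  filter_upwards [Ioo_mem_nhdsGT hε₀] with ε hε
  obtain ⟨hε0, hεε₀⟩ := hε
  have hεδ₂ : ε < δ₂ := hεε₀.trans_le (min_le_left _ _)
  have hεη : ε * ‖w‖ + κ * ε < η := by
    have h1 : ε < η / (‖w‖ + κ + 1) := hεε₀.trans_le (min_le_right _ _)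
    rw [lt_div_iff₀ hwκ] at h1
    nlinarith
  have hεη' : ε * ‖w‖ < η := by nlinarith
  -- approaching the loop along the complementary arc
  have h01 : Λ 0 = Λ 1 := P.loopCurve_zero_eq_one hpa
  have happ : ∀ μ : ℝ, μ = ε ∨ μ = -ε →
      P.windAt a b (t₀ + μ) = wind (fun s => Λ s - (y + μ * w)) := by
    intro μ hμ
    have hμa : |μ| = ε := by rcases hμ with rfl | rfl <;> simp [abs_of_pos hε0]
    have hμ0 : μ ≠ 0 := by rintro rfl; simp at hμa; exact hε0.ne' hμa.symm
    unfold windAt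
    refine wind_sub_eq_of_near P.continuous_loopCurve h01 hcone hfar hκ hμ0
      (by rw [hμa]; exact hεη) ?_
    have := hcone₂ (t₀ + μ) (by rw [add_sub_cancel_left, hμa]; exact hεδ₂)
    rw [hγt₀, add_sub_cancel_left, hμa] at this
    rw [← sub_sub, hμa]
    exact this
  have hplus : P.windAt a b (t₀ + ε) = wind (fun s => Λ s - (y + ε * w)) := happ ε (Or.inl rfl)
  have hminus : P.windAt a b (t₀ - ε) = wind (fun s => Λ s - (y - ε * w)) := by
    rw [sub_eq_add_neg, happ (-ε) (Or.inr rfl)]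
    congr 1
    ext s
    push_cast
    ring
  rw [hplus, hminus]
  rcases lt_or_gt_of_ne hD with hneg | hpos
  · left
    exact wind_sub_wind_eq_one P.continuous_loopCurve h01 hδ0 hδσ hσδ hΛσ₀ hcone hfar hκ0.le
      hκ hneg hε0 hεη'
  · right
    have hκ' : κ * (‖V‖ + ‖-w‖) < |(V * starRingEnd ℂ (-w)).im| := by
      rwa [norm_neg, map_neg, mul_neg, Complex.neg_im, abs_neg]
    have hneg : (V * starRingEnd ℂ (-w)).im < 0 := by
      rw [map_neg, mul_neg, Complex.neg_im, neg_lt_zero]; exact hpos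
    have := wind_sub_wind_eq_one P.continuous_loopCurve h01 hδ0 hδσ hσδ hΛσ₀ hcone hfar hκ0.le
      hκ' hneg hε0 (by rwa [norm_neg])
    have e1 : (fun s => Λ s - (y + ε * -w)) = fun s => Λ s - (y - ε * w) := by ext s; ring
    have e2 : (fun s => Λ s - (y - ε * -w)) = fun s => Λ s - (y + ε * w) := by ext s; ring
    rw [e1, e2] at this
    linarith

/-- **The corner at the base point.** Just after leaving the double point of `{a, b}` along the
complementary arc (at `θ b + ε`) and just before returning to it (at `θ a + 2π - ε`) the winding
numbers of the loop agree, for all small `ε > 0`. [folklore] -/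
theorem windAt_corner (hab : a < b) (hpa : P.diagram.partner a = b) :
    ∀ᶠ ε in 𝓝[>] (0 : ℝ), P.windAt a b (P.θ b + ε) = P.windAt a b (P.θ a + 2 * π - ε) := by
  have hc : 0 < P.θ b - P.θ a := sub_pos.2 (P.θ_lt_θ hab)
  set c := P.θ b - P.θ a with hc_def
  set Λ := P.loopCurve a b with hΛ_def
  set y := K.cplaneCurve (P.θ a) with hy_def
  have hγb : K.cplaneCurve (P.θ b) = y := by rw [hy_def, ← hpa, cplaneCurve_θ_partner]
  have hΛ0 : Λ 0 = y := P.loopCurve_zero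
  have hΛ1 : Λ 1 = y := P.loopCurve_one.trans hγb
  set va := K.cplaneDeriv (P.θ a) with hva_def
  set vb := K.cplaneDeriv (P.θ b) with hvb_def
  set Va := (c : ℂ) * va with hVa_def
  set Vb := (c : ℂ) * vb with hVb_def
  have hΛd0 : HasDerivAt Λ Va 0 := by
    have := P.hasDerivAt_loopCurve (a := a) (b := b) 0
    rwa [loopParam_zero] at this
  have hΛd1 : HasDerivAt Λ Vb 1 := by
    have := P.hasDerivAt_loopCurve (a := a) (b := b) 1
    rwa [loopParam_one] at this
  have hγda : HasDerivAt K.cplaneCurve va (P.θ a) := P.hasDerivAt_cplaneCurve _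
  have hγdb : HasDerivAt K.cplaneCurve vb (P.θ b) := P.hasDerivAt_cplaneCurve _
  have hab' : (va * starRingEnd ℂ vb).im ≠ 0 := by
    have h := P.im_mul_conj_partner_ne_zero a
    rw [hpa] at h
    rw [← Complex.conj_conj (va * _), map_mul, Complex.conj_conj, mul_comm, Complex.conj_im]
    exact fun h' => h (neg_eq_zero.1 h')
  have hD : (Va * starRingEnd ℂ Vb).im ≠ 0 := by
    have e1 : Va * starRingEnd ℂ Vb = ((c * c : ℝ) : ℂ) * (va * starRingEnd ℂ vb) := by
      simp only [hVa_def, hVb_def, map_mul, Complex.conj_ofReal]; push_cast; ring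
    rw [e1, Complex.im_ofReal_mul]
    exact mul_ne_zero (mul_pos hc hc).ne' hab'
  -- constants
  set D := |(Va * starRingEnd ℂ Vb).im| with hD_def
  have hD0 : 0 < D := abs_pos.2 hD
  set κ := D / (2 * (‖Va‖ + ‖Vb‖ + 1)) with hκ_def
  have hnn : 0 < ‖Va‖ + ‖Vb‖ + 1 := by positivity
  have hκ0 : 0 < κ := by positivity
  have hκ : κ * (‖Va‖ + ‖Vb‖) < D := by
    have h1 : κ * (‖Va‖ + ‖Vb‖ + 1) = D / 2 := by rw [hκ_def]; field_simp
    nlinarith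
  have hκc : 0 < κ / c := div_pos hκ0 hc
  obtain ⟨δ₁, hδ₁, hcone₁⟩ := hΛd0.exists_cone hκ0
  obtain ⟨δ₂, hδ₂, hcone₂⟩ := hΛd1.exists_cone hκ0
  obtain ⟨δ₃, hδ₃, hcone₃⟩ := hγdb.exists_cone hκc
  obtain ⟨δ₄, hδ₄, hcone₄⟩ := hγda.exists_cone hκc
  set δ := min (δ₁ / 2) (min (δ₂ / 2) (1 / 4)) with hδ_def
  have hδ0 : 0 < δ := by
    simp only [hδ_def, lt_min_iff]; exact ⟨by linarith, by linarith, by norm_num⟩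
  have hδδ₁ : δ < δ₁ := (min_le_left _ _).trans_lt (by linarith)
  have hδδ₂ : δ < δ₂ := ((min_le_right _ _).trans (min_le_left _ _)).trans_lt (by linarith)
  have hδ1 : δ < 1 := ((min_le_right _ _).trans (min_le_right _ _)).trans_lt (by norm_num)
  have hcone0 : ∀ s, |s| ≤ δ → ‖Λ s - y - (s : ℂ) * Va‖ ≤ κ * |s| := fun s hs => by
    have := hcone₁ s (by rw [sub_zero]; exact hs.trans_lt hδδ₁)
    rwa [hΛ0, sub_zero] at this
  have hcone1 : ∀ s, |s - 1| ≤ δ → ‖Λ s - y - ((s - 1 : ℝ) : ℂ) * Vb‖ ≤ κ * |s - 1| :=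
    fun s hs => by
    have := hcone₂ s (hs.trans_lt hδδ₂)
    rwa [hΛ1] at this
  -- far from the corner the loop stays away from the base point
  have hne : ∀ s ∈ Icc δ (1 - δ), Λ s ≠ y := by
    intro s hs h
    have hs01 : s ∈ Icc (0 : ℝ) 1 := ⟨hδ0.le.trans hs.1, hs.2.trans (by linarith)⟩
    obtain ⟨k, hk | hk⟩ := P.eq_θ_or_eq_θ_partner (r := a) h
    · have hmem : P.θ a + k * (2 * π) ∈ Icc (P.θ a) (P.θ b) := hk ▸ P.loopParam_mem_Icc hab hs01
      obtain ⟨rfl, -, -⟩ := P.mem_Icc_of_θ_add_mem_Icc hmem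
      have h0 : P.loopParam a b s = P.loopParam a b 0 := by rw [loopParam_zero]; simpa using hk
      have := (P.strictMono_loopParam hab).injective h0
      rw [this] at hs; linarith [hs.1]
    · rw [hpa] at hk
      have hmem : P.θ b + k * (2 * π) ∈ Icc (P.θ a) (P.θ b) := hk ▸ P.loopParam_mem_Icc hab hs01
      obtain ⟨rfl, -, -⟩ := P.mem_Icc_of_θ_add_mem_Icc hmem
      have h0 : P.loopParam a b s = P.loopParam a b 1 := by rw [loopParam_one]; simpa using hk
      have := (P.strictMono_loopParam hab).injective h0
      rw [this] at hs; linarith [hs.2]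
  obtain ⟨η, hη, hfar'⟩ := exists_pos_forall_le_norm_sub isCompact_Icc
    P.continuous_loopCurve.continuousOn hne
  have hfar : ∀ s ∈ Icc (0 : ℝ) 1, δ ≤ s → s ≤ 1 - δ → η ≤ ‖Λ s - y‖ := fun s _ h1 h2 =>
    hfar' s ⟨h1, h2⟩
  -- small `ε`
  set M := ‖Va‖ + ‖Vb‖ + κ + 1 with hM_def
  have hM : 0 < M := by positivity
  set ε₀ := min δ₃ (min δ₄ (η * c / M)) with hε₀_def
  have hε₀ : 0 < ε₀ := lt_min hδ₃ (lt_min hδ₄ (div_pos (mul_pos hη hc) hM))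
  filter_upwards [Ioo_mem_nhdsGT hε₀] with ε₁ hε₁
  obtain ⟨hε₁0, hε₁ε₀⟩ := hε₁
  have hε₁δ₃ : ε₁ < δ₃ := hε₁ε₀.trans_le (min_le_left _ _)
  have hε₁δ₄ : ε₁ < δ₄ := hε₁ε₀.trans_le ((min_le_right _ _).trans (min_le_left _ _))
  have hε₁η : ε₁ < η * c / M := hε₁ε₀.trans_le ((min_le_right _ _).trans (min_le_right _ _))
  set ε := ε₁ / c with hε_def
  have hε : 0 < ε := div_pos hε₁0 hc
  have hεη : ε * (‖Va‖ + ‖Vb‖ + κ) < η := by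
    rw [lt_div_iff₀ hM] at hε₁η
    have : ε * M < η := by
      rw [hε_def, div_mul_eq_mul_div, div_lt_iff₀ hc]; linarith
    nlinarith
  -- the two points
  set ep := K.cplaneCurve (P.θ b + ε₁) - y - (ε₁ : ℂ) * vb with hep_def
  set em := K.cplaneCurve (P.θ a - ε₁) - y - ((-ε₁ : ℝ) : ℂ) * va with hem_def
  have hep : ‖ep‖ ≤ κ * ε := by
    have := hcone₃ (P.θ b + ε₁) (by rw [add_sub_cancel_left, abs_of_pos hε₁0]; exact hε₁δ₃)
    rw [hγb, add_sub_cancel_left, abs_of_pos hε₁0] at this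
    rw [hep_def, hε_def]
    calc _ ≤ κ / c * ε₁ := this
      _ = κ * (ε₁ / c) := by ring
  have hem : ‖em‖ ≤ κ * ε := by
    have := hcone₄ (P.θ a - ε₁) (by rw [sub_sub_cancel_left, abs_neg, abs_of_pos hε₁0]; exact hε₁δ₄)
    rw [sub_sub_cancel_left, abs_neg, abs_of_pos hε₁0] at this
    rw [hem_def, hε_def]
    calc _ ≤ κ / c * ε₁ := this
      _ = κ * (ε₁ / c) := by ring
  have hc' : (c : ℂ) ≠ 0 := by exact_mod_cast hc.ne'
  have hεc : (ε : ℂ) * (c : ℂ) = ε₁ := by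
    rw [hε_def]; push_cast; exact div_mul_cancel₀ _ hc'
  have hPp : K.cplaneCurve (P.θ b + ε₁) = y + (ε : ℂ) * Vb + ep := by
    rw [hep_def, hVb_def, ← mul_assoc, hεc]; ring
  have hPm : K.cplaneCurve (P.θ a + 2 * π - ε₁) = y - (ε : ℂ) * Va + em := by
    rw [show P.θ a + 2 * π - ε₁ = (P.θ a - ε₁) + 2 * π by ring, K.periodic_cplaneCurve,
      hem_def, hVa_def, ← mul_assoc, hεc]
    push_cast; ring
  unfold windAt
  rw [hPp, hPm]
  exact wind_sub_eq_of_corner P.continuous_loopCurve hΛ0 hΛ1 hcone0 hcone1 hfar hκ hε hεη hep hem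

end Jump

/-! ### Counting: the number of interlaced chords is even -/

section Count

variable {a b : Fin (2 * P.diagram.n)}

/-- Cross times of distinct marked points outside `[a, b]` are distinct. [folklore] -/
theorem crossTime_injective : Function.Injective (P.crossTime b) := by
  intro q q' h
  unfold crossTime at h
  split_ifs at h with h1 h2 h2
  · exact P.injective_θ h
  · linarith [P.lt_add_two_pi q q']
  · linarith [P.lt_add_two_pi q' q]
  · exact P.injective_θ (by linarith)

/-- A positive gap eventually exceeds `2ε` as `ε → 0⁺`. [folklore] -/
theorem eventually_two_mul_lt {d : ℝ} (hd : 0 < d) : ∀ᶠ ε in 𝓝[>] (0 : ℝ), 2 * ε < d := by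
  filter_upwards [Ioo_mem_nhdsGT (half_pos hd)] with ε hε
  linarith [hε.2]

/-- **Gauss's parity theorem, counting form: the loop cut off by a chord is crossed an even number
of times by the complementary arc.** The number of chords interlaced with `{a, b}` is even: order
the cross times `t₁ < ⋯ < tₘ` in `(θ b, θ a + 2π)`; the winding number of the loop about the
moving point `γ t` is constant between consecutive cross times (`windAt_eq_windAt`), jumps by `±1`
at each of them (`windAt_crossTime_add_sub`), and returns to its initial value at the corner
(`windAt_corner`); so a sum of `m` odd numbers vanishes and `m` is even. (Gauss, *Werke* VIII,
272 and 282–286; for the winding-number argument cf. Ahlfors, *Complex Analysis*, §4.2.1.)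
[folklore] -/
theorem even_card_crossSet (hab : a < b) (hpa : P.diagram.partner a = b) :
    Even (P.crossSet a b).card := by
  classical
  set Q := P.crossSet a b with hQ_def
  set T : Finset ℝ := Q.image (P.crossTime b) with hT_def
  have hTQ : T.card = Q.card :=
    Finset.card_image_of_injective _ P.crossTime_injective
  rw [← hTQ]
  -- the times are in the complementary window
  have hT_mem : ∀ t ∈ T, ∃ q ∈ Q, P.crossTime b q = t := fun t ht => by
    simpa [hT_def] using ht
  have hT_Ioo : ∀ t ∈ T, t ∈ Ioo (P.θ b) (P.θ a + 2 * π) := fun t ht => by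
    obtain ⟨q, hq, rfl⟩ := hT_mem t ht
    exact P.crossTime_mem_Ioo (P.mem_crossSet.1 hq).1
  have hT_jump : ∀ t ∈ T, ∀ᶠ ε in 𝓝[>] (0 : ℝ),
      P.windAt a b (t + ε) - P.windAt a b (t - ε) = 1 ∨
      P.windAt a b (t + ε) - P.windAt a b (t - ε) = -1 := fun t ht => by
    obtain ⟨q, hq, rfl⟩ := hT_mem t ht
    exact P.windAt_crossTime_add_sub hab hpa hq
  -- no cross time off `T`
  have hT_no : ∀ q ∈ Q, P.crossTime b q ∈ T := fun q hq => Finset.mem_image_of_mem _ hq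
  -- enumerate the times increasingly
  rcases Nat.eq_zero_or_eq_succ_pred T.card with h0 | hsucc
  · rw [h0]; exact ⟨0, rfl⟩
  set n := T.card.pred with hn_def
  have hTn : T.card = n + 1 := hsucc
  set e := T.orderEmbOfFin hTn with he_def
  have he_mem : ∀ k, e k ∈ T := fun k => Finset.orderEmbOfFin_mem T hTn k
  have he_surj : ∀ t ∈ T, ∃ k, e k = t := fun t ht => by
    have : t ∈ Set.range e := by rw [he_def, Finset.range_orderEmbOfFin]; exact ht
    exact this
  -- choose `ε`
  have hev : ∀ᶠ ε in 𝓝[>] (0 : ℝ), 0 < ε ∧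
      P.windAt a b (P.θ b + ε) = P.windAt a b (P.θ a + 2 * π - ε) ∧
      (∀ k : Fin (n + 1), P.windAt a b (e k + ε) - P.windAt a b (e k - ε) = 1 ∨
        P.windAt a b (e k + ε) - P.windAt a b (e k - ε) = -1) ∧
      (∀ k : Fin (n + 1), 2 * ε < e k - P.θ b ∧ 2 * ε < P.θ a + 2 * π - e k) ∧
      (∀ k k' : Fin (n + 1), k < k' → 2 * ε < e k' - e k) := by
    refine (eventually_mem_nhdsWithin.mono fun ε hε => ?_).and
      ((P.windAt_corner hab hpa).and ((eventually_all.2 fun k => hT_jump _ (he_mem k)).and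
        ((eventually_all.2 fun k => ?_).and (eventually_all.2 fun k => eventually_all.2 fun k' => ?_))))
    · exact hε
    · obtain ⟨h1, h2⟩ := hT_Ioo _ (he_mem k)
      exact (eventually_two_mul_lt (sub_pos.2 h1)).and (eventually_two_mul_lt (sub_pos.2 h2))
    · by_cases hkk : k < k'
      · have hlt : e k < e k' := e.strictMono hkk
        exact (eventually_two_mul_lt (sub_pos.2 hlt)).mono fun ε h _ => h
      · exact Filter.Eventually.of_forall fun ε h => absurd h hkk
  obtain ⟨ε, hε0, hcor, hjmp, hbd, hgap⟩ := hev.exists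
  -- the values just before and just after the cross times
  set A : Fin (n + 1) → ℤ := fun k => P.windAt a b (e k - ε) with hA_def
  set B : Fin (n + 1) → ℤ := fun k => P.windAt a b (e k + ε) with hB_def
  -- no element of `T` strictly within `2ε`-trimmed gaps
  have hnoT : ∀ {t₁ t₂ : ℝ} (q : Fin (2 * P.diagram.n)), q ∈ Q →
      (∀ k, e k < t₁ ∨ t₂ < e k) → P.crossTime b q ∉ Icc t₁ t₂ := by
    intro t₁ t₂ q hq hk hmem
    obtain ⟨k, hk'⟩ := he_surj _ (hT_no q hq)
    rcases hk k with h | h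
    · rw [hk'] at h; linarith [hmem.1]
    · rw [hk'] at h; linarith [hmem.2]
  -- (a) the first value is the value after the corner
  have hA0 : A 0 = P.windAt a b (P.θ b + ε) := by
    simp only [hA_def]
    symm
    obtain ⟨hb1, hb2⟩ := hbd 0
    refine P.windAt_eq_windAt hab hpa (by linarith) (fun t ht => ⟨by linarith [ht.1], ?_⟩)
      fun q hq => hnoT q hq fun k => Or.inr ?_
    · have := (hT_Ioo _ (he_mem 0)).2; linarith [ht.2]
    · have : e 0 ≤ e k := e.monotone (Fin.zero_le k)
      linarith
  -- (b) the last value is the value before the corner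
  have hBlast : B (Fin.last n) = P.windAt a b (P.θ a + 2 * π - ε) := by
    simp only [hB_def]
    obtain ⟨hb1, hb2⟩ := hbd (Fin.last n)
    refine P.windAt_eq_windAt hab hpa (by linarith) (fun t ht => ⟨?_, by linarith [ht.2]⟩)
      fun q hq => hnoT q hq fun k => Or.inl ?_
    · have := (hT_Ioo _ (he_mem (Fin.last n))).1; linarith [ht.1]
    · have : e k ≤ e (Fin.last n) := e.monotone (Fin.le_last k)
      linarith
  -- (c) consecutive values agree
  have hBA : ∀ k : Fin n, B k.castSucc = A k.succ := by
    intro k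
    simp only [hA_def, hB_def]
    have hlt : k.castSucc < k.succ := Fin.castSucc_lt_succ
    have hg := hgap _ _ hlt
    refine P.windAt_eq_windAt hab hpa (by linarith) (fun t ht => ⟨?_, ?_⟩)
      fun q hq => hnoT q hq fun j => ?_
    · have := (hT_Ioo _ (he_mem k.castSucc)).1; linarith [ht.1]
    · have := (hT_Ioo _ (he_mem k.succ)).2; linarith [ht.2]
    · rcases lt_or_ge j k.succ with h | h
      · left
        have hj : j ≤ k.castSucc := Fin.le_castSucc_iff.2 h
        have := e.monotone hj
        linarith
      · right
        have := e.monotone h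
        linarith
  -- (d) telescope
  have hsum : ∑ k : Fin (n + 1), (B k - A k) = 0 := by
    rw [Finset.sum_sub_distrib, Fin.sum_univ_castSucc, Fin.sum_univ_succ]
    simp only [hBA]
    rw [hBlast, hA0, hcor]
    ring
  -- (e) parity
  have hodd : ∀ k : Fin (n + 1), ((B k - A k : ℤ) : ZMod 2) = 1 := by
    intro k
    rcases hjmp k with h | h
    · simp only [hA_def, hB_def] at h ⊢; rw [h]; simp
    · simp only [hA_def, hB_def] at h ⊢; rw [h]; decide
  have hcast := congrArg (fun z : ℤ => (z : ZMod 2)) hsum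
  simp only [Int.cast_sum, hodd, Finset.sum_const, Finset.card_univ, Fintype.card_fin,
    nsmul_eq_mul, mul_one, Int.cast_zero] at hcast
  rw [hTn]
  exact (ZMod.natCast_eq_zero_iff_even).1 hcast

/-- **The number of marked points strictly between `a` and `b` has the parity of the number of
chords interlaced with `{a, b}`**: the other points inside come in partner pairs. [folklore] -/
theorem card_Ioo_mod_two (hpa : P.diagram.partner a = b) :
    (b.val - a.val - 1) % 2 = (P.crossSet a b).card % 2 := by
  classical
  have hpb : P.diagram.partner b = a := P.partner_eq_of_partner_eq hpa
  set I := Finset.Ioo a b with hI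
  have hIcard : I.card = b.val - a.val - 1 := by rw [hI, Fin.card_Ioo]
  set I₁ := I.filter fun p => a < P.diagram.partner p ∧ P.diagram.partner p < b with hI₁
  set I₂ := I.filter fun p => ¬ (a < P.diagram.partner p ∧ P.diagram.partner p < b) with hI₂
  have hsplit : I₁.card + I₂.card = I.card := Finset.card_filter_add_card_filter_not _
  -- the inner partner pairs
  have h₁ : Even I₁.card := by
    refine GaussDiagram.even_card_of_involutive I₁ P.diagram.partner (fun p hp => ?_)
      (fun p _ => P.diagram.partner_partner p) (fun p _ => P.diagram.partner_ne p)
    simp only [hI₁, hI, Finset.mem_filter, Finset.mem_Ioo] at hp ⊢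
    rw [GaussDiagram.partner_partner]
    exact ⟨hp.2, hp.1⟩
  -- the inner ends of interlaced chords
  have h₂ : I₂.card = (P.crossSet a b).card := by
    refine Finset.card_bij' (fun p _ => P.diagram.partner p) (fun q _ => P.diagram.partner q)
      (fun p hp => ?_) (fun q hq => ?_) (fun p _ => P.diagram.partner_partner p)
      (fun q _ => P.diagram.partner_partner q)
    · simp only [hI₂, hI, Finset.mem_filter, Finset.mem_Ioo] at hp
      obtain ⟨⟨hap, hpb'⟩, hnot⟩ := hp
      refine P.mem_crossSet.2 ⟨fun ⟨h1, h2⟩ => ?_, by rw [GaussDiagram.partner_partner]; exact ⟨hap, hpb'⟩⟩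
      rcases h1.lt_or_eq with h1 | h1
      · rcases h2.lt_or_eq with h2 | h2
        · exact hnot ⟨h1, h2⟩
        · have : p = a := by rw [← P.diagram.partner_partner p, h2, hpb]
          rw [this] at hap; exact lt_irrefl _ hap
      · have : p = b := by rw [← P.diagram.partner_partner p, ← h1, hpa]
        rw [this] at hpb'; exact lt_irrefl _ hpb'
    · obtain ⟨hout, hin1, hin2⟩ := P.mem_crossSet.1 hq
      simp only [hI₂, hI, Finset.mem_filter, Finset.mem_Ioo, GaussDiagram.partner_partner]
      exact ⟨⟨hin1, hin2⟩, fun ⟨h1, h2⟩ => hout ⟨h1.le, h2.le⟩⟩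
  obtain ⟨r, hr⟩ := h₁
  rw [← hIcard, ← hsplit, ← h₂, hr]
  omega

/-- **Gauss's parity theorem for a chord `{a, b}`, `a < b = partner a`**: the two positions have
different parity. [folklore] -/
theorem val_mod_two_ne (hab : a < b) (hpa : P.diagram.partner a = b) : a.val % 2 ≠ b.val % 2 := by
  have h1 := P.card_Ioo_mod_two hpa
  obtain ⟨r, hr⟩ := P.even_card_crossSet hab hpa
  have hlt : a.val < b.val := hab
  omega

end Count

/-- **Gauss's parity condition for regular projections of knots.** In the Gauss diagram read off
a regular projection, the two passages through every crossing occupy positions of different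
parity: walking along the knot from one passage through a crossing to the other, one passes an
even number of times through crossings. This is Gauss's necessary condition for a Gauss word to
be realisable by a closed normal plane curve (C. F. Gauss, *Werke* VIII, pp. 272, 282–286), in
the form of Kauffman (1999), §3.2, Lemma 1: *a planar Gauss code is evenly intersticed* ("this
follows directly from the Jordan curve theorem in the plane"). Proof: the loop `γ([θ a, θ b])` cut
off by the chord is crossed transversally by the complementary arc exactly at the double points
of the chords interlaced with `{a, b}`; the winding number of the loop about the moving point of
the complementary arc jumps by `±1` at each of them and returns to its initial value, so their
number is even (`even_card_crossSet`), and it has the parity of `b - a - 1` (`card_Ioo_mod_two`).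
[cite: Kauffman1999, §3.2 Lemma 1] -/
theorem overPos_mod_two_ne_underPos_mod_two (i : Fin P.diagram.n) :
    (P.diagram.overPos i).val % 2 ≠ (P.diagram.underPos i).val % 2 := by
  rcases lt_trichotomy (P.diagram.overPos i) (P.diagram.underPos i) with h | h | h
  · exact P.val_mod_two_ne h (P.diagram.partner_overPos i)
  · exact absurd h (P.diagram.overPos_ne_underPos i i)
  · exact (P.val_mod_two_ne h (P.diagram.partner_underPos i)).symm

/-- Gauss's parity condition, additive form: `overPos i + underPos i` is odd. Kauffman (1999),
§3.2, Lemma 1. [cite: Kauffman1999, §3.2 Lemma 1] -/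
theorem odd_overPos_add_underPos (i : Fin P.diagram.n) :
    Odd ((P.diagram.overPos i).val + (P.diagram.underPos i).val) := by
  have h := P.overPos_mod_two_ne_underPos_mod_two i
  rw [Nat.odd_iff]
  omega

end RegularProjection

end Knot

end Literature.Topology.FourManifolds

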